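import Literature.NumberTheory.Automorphic.Liu2021.LemD1AsPrintedIndexedNonVacuityNonsplit
import HarnessLib

/-!
# [Liu2021, App. D Lemma D.1 (1) ∧ (3)] on an indexed collection — NON-VACUITY AT A RAMIFIED PLACE
# (`F = ℚ₃`, `E = ℚ₃(√3)` a FIELD: the flip `ε ↦ −ε` of the Step-1 representative CHANGES the class in `E^{−×}/Nm_{E/F} E^×`,
# and ALONE decides the printed criterion (3) at the rows' rank `n = 3`)

Reproduction ∕ bookkeeping (Literature, theorems only, no record, no definition, nothing asserted about Liu's objects).
Companion of `LemD1AsPrintedIndexedNonVacuityNonsplit.lean` (the UNRAMIFIED non-split place `ℚ₃(i)/ℚ₃`, where `−1 = Nm(√−2 + i)`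
IS a norm, so that `−ε` and `ε` always lie in the SAME class of `E^{−×}/Nm E^×` — `sameClass_iff` there: the class of `b i` is the
parity of `ord₃ b` — while `3ε` lies in the other class).  Items (2) and (4) of [Liu2021, Lemma D.1] are phrased with the flipped
representative: «(2) The contragredient representation of `ω(μ, ε, χ)` is isomorphic to `ω(μ^c, −ε, χ^{−1})`» (l. 5231), «(4) … and
`ε' = ε` (resp. `ε' ≠ ε`) when `V` is isotropic (resp. anisotropic)» (l. 5235); whether `−ε` is a DIFFERENT element of
`E^{−×}/Nm_{E/F} E^×` than `ε` depends on the place: it is iff `−1 ∉ Nm_{E/F} E^×`.  The statement-exact records exercised here are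
`LemD1IndexedFamily.Item1AsPrinted` (Lemma D.1, first sentence + (1)) and `LemD1_3AsPrintedI` (Lemma D.1 (3), «`ε' = ε`» read in
`E^{−×}/Nm_{E/F} E^×`, READING L3′ `LemD1.SameClass`) of `LemD1AsPrintedIndexed.lean` — PREDICATES on a consumer's datum.

THIS FILE builds the standing data of §D.1 at the RAMIFIED quadratic extension `E = ℚ₃(√3)` = Mathlib's
`QuadraticAlgebra ℚ_[3] 3 0` (`ω² = 3`), involution `c : √3 ↦ −√3` (Mathlib's `star`), and proves IN THE KERNEL:

* §1 (three-adic, folklore): `‖a² − 3 b²‖₃ = max(‖a‖₃², 3⁻¹ ‖b‖₃²)` — the two terms have `3`-adic valuations of different parity,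
  so they never cancel; hence `3` is not a square in `ℚ₃` (`E` is a FIELD, `isField`), `−1` is NOT a norm from `E`
  (`norm_ne_neg_one`: a unit norm `a² − 3b²` is `≡ a² ≡ 1 (mod 3)`), and `3` is NOT a norm (`norm_ne_three`), while `−3 = Nm(√3)`.
* §2 for standing data `S` on `E` with `S.conj = star`: Step-1 representatives are `ε = b√3`, `b ∈ ℚ₃^×`; and
  **`not_sameClass_epsNeg`: for EVERY representative `ε`, `−ε` (the tree's `LemD1.epsNeg ε`) is NOT in the class of `ε`** —
  the flip of items (2)/(4) is visible in `E^{−×}/Nm E^×` at this place —; likewise `3ε ≁ ε` (`not_sameClass_of_eq_three_mul`),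
  whereas `−3ε ∼ ε` (`sameClass_of_eq_neg_three_mul`: `−3 ε = √3 · (√3)^c · ε`).  So `[ε] ≠ [−ε] = [3ε]`.
* §3 the standing data exist (`exists_standingData`: `F = ℚ₃` non-archimedean local field by the tree's
  `Padic.isNonarchimedeanLocalField_holds`, `E/F` étale of rank `2`, Gram matrix `1`, any rank `n ≥ 2`), so §2 is not vacuous:
  `exists_epsRep_not_sameClass_epsNeg`.
* §4 Step 2 at the ramified place.  `muSet_apply_three`: EVERY character `μ` of the printed index set `MuSet S` (Step 2: «`μ|_{F^×}`
  is the unique character whose kernel is exactly `Nm_{E/F} E^×`») has `μ(3) = −1` (`3 ∉ Nm E^×`, `9 = Nm(3)`), so `μ(√3)² = −1`: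
  Step-2 characters at a ramified place have order divisible by `4` (at the unramified place `μ = (−1)^{ord_E}` of order `2`
  qualifies).  `exists_muSet_sq_sqrt_three` (construction `nonempty_muSet_ramified`): such a `μ` EXISTS — `μ(z) = I^{k} · (a₀ | 3)`, `k = ord₃ Nm(z)` (the valuation for the uniformiser
  `√3`), `z (√3)^{−k} = a₀ + b₀√3` the unit part, `( | 3)` the Legendre symbol of `a₀ mod 3`; unitary, locally constant, and its
  restriction `t ↦ (−1)^{ord₃ t} (t 3^{−ord₃ t} | 3)` to `ℚ₃^×` has kernel EXACTLY `Nm E^×` (both inclusions proved: a unit norm is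
  `≡ a₀² ≡ 1`; conversely Hensel — the tree's `padicInt_isSquare_of_toZMod_eq_one` — and `−3 = Nm(√3)`).
* §5 `exists_cubicChar`: the CUBIC character `ψ` of `E¹` — for `z = a + b√3 ∈ E¹` (`a ∈ ℤ₃^×`, `b ∈ ℤ₃`) the digit `φ(z) = ā b̄ ∈ 𝔽₃`
  is additive (one `decide` on `𝔽₃`), `ψ = ζ₃^φ`; unitary, locally constant, `ψ³ = 1`, `ψ(2 + √3) = ζ₃² ≠ 1`; at rank `3` the line
  `ψ ∘ det` has TRIVIAL central character.
* §6 THE CERTIFICATE `exists_lemD1IndexedFamily_ramified_flip`: rank `n = 3` (the rows' rank), Gram `1`, TWO members with the SAME `μ`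
  (§4) and the SAME `χ = 1`, representatives `ε₀ = √3` and `ε₁ = −√3 = LemD1.epsNeg ε₀` — exactly the flipped representative of item
  (2) —, carriers the trivial line and `ψ ∘ det`: `Item1AsPrinted ∧ LemD1_3AsPrintedI` (all four pairs), `[ε₁] ≠ [ε₀]`, and
  `ω(μ, −ε, χ) ≇ ω(μ, ε, χ)` (separated at `diag(2 + √3, 1, 1)`).  So the FLIP ALONE is the deciding conjunct of the printed
  criterion (3) at `n = 3` over a field; §7 closes the topological instance hypotheses with the module topology.

The topology of `E` enters only through `[TopologicalSpace E] [IsTopologicalRing E] [IsModuleTopology ℚ_[3] E]` (the records' own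
field `isModuleTopology`); §7 instantiates them with Mathlib's `moduleTopology`, so no instance is declared.

Scope (T5-style consistency, our bookkeeping): no contradiction is derivable from
`(Lf : LemD1IndexedFamily …) (h₁ : Lf.Item1AsPrinted) (h₃ : LemD1_3AsPrintedI Lf)` together with «`E` is a field» and «two members
with the same `μ`, `χ` whose representatives are `ε` and `−ε`, in different classes»; nothing here concerns Liu's `ω(μ, ε)`, the truth
of Lemma D.1, or the tree's constructed local data (there `E_v` is a `Π`-type over the places above `v`; this file's `E` is
Mathlib's `QuadraticAlgebra`).

Cell pub-hodgecm2 (COR-CM), audit-class own-lane leaf of seat prover-pub-hodgecm2-b10 (lineage of `LemD1AsPrintedIndexed*.lean`).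
HC_CM is NOT proved.

References: Y. Liu, *Fourier–Jacobi cycles and arithmetic relative trace formula*, Camb. J. Math. 9 (2021) = arXiv:2102.11518
[Liu2021], App. D §D.1 Steps 1–3 (l. 5217–5221), Lemma D.1 (1) (l. 5229), (2) (l. 5231), (3) (l. 5233), (4) (l. 5235); proof,
field case (l. 5243, 5255).  J.-P. Serre, *A Course in Arithmetic* (1973), Ch. II §3.3 (squares in `ℚ_p`), via the tree's
`Literature/NumberTheory/QuadraticForms/PadicSquares.lean` [Serre1973].
-/

noncomputable section

open Literature.RepresentationTheory.Liu2021 (OscillatorStandingData)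
open Literature.RepresentationTheory.CentralCharacterQuotient (augmentation quotRep quotRep_mk)

namespace Literature.NumberTheory.Automorphic.Liu2021

namespace LemD1IndexedNonVacuityRamified

/-! ## §1 Three-adic lemmas for the norm form `a² − 3b²` of `ℚ₃(√3)/ℚ₃` -/

section ThreeAdic

/-- In `𝔽₃` no square is `−1 = 2`. [folklore] -/
private theorem zmod3_sq_ne_two : ∀ x : ZMod 3, x ^ 2 ≠ 2 := by decide

/-- A `3`-adic integer reduces to `0` mod `3` iff its norm is `< 1`. [folklore] -/
private theorem toZMod_eq_zero_iff (x : ℤ_[3]) : PadicInt.toZMod x = 0 ↔ ‖x‖ < 1 := by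
  rw [← RingHom.mem_ker, PadicInt.ker_toZMod, IsLocalRing.mem_maximalIdeal, PadicInt.mem_nonunits]

/-- **`‖a² − 3b²‖₃ = max(‖a‖₃², 3⁻¹‖b‖₃²)`** for all `a, b ∈ ℚ₃`: the valuations of `a²` (even) and `3b²` (odd) differ, so the
ultrametric inequality is an equality. [folklore] -/
private theorem norm_sq_sub_three_mul_sq (a b : ℚ_[3]) : ‖a ^ 2 - 3 * b ^ 2‖ = max (‖a‖ ^ 2) (3⁻¹ * ‖b‖ ^ 2) := by
  have h3 : ‖(3 : ℚ_[3])‖ = 3⁻¹ := by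
    have := Padic.norm_p (p := 3)
    exact_mod_cast this
  have hna : ‖a ^ 2‖ = ‖a‖ ^ 2 := norm_pow _ _
  have hnb : ‖-(3 * b ^ 2)‖ = 3⁻¹ * ‖b‖ ^ 2 := by rw [norm_neg, norm_mul, norm_pow, h3]
  by_cases ha : a = 0
  · subst ha
    simp only [ne_eq, OfNat.ofNat_ne_zero, not_false_eq_true, zero_pow, norm_zero, zero_sub, norm_neg, norm_mul,
      norm_pow, h3]
    exact (max_eq_right (by positivity)).symm
  by_cases hb : b = 0
  · subst hb
    simp only [ne_eq, OfNat.ofNat_ne_zero, not_false_eq_true, zero_pow, mul_zero, sub_zero, norm_pow, norm_zero]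
    exact (max_eq_left (by positivity)).symm
  have hne : ‖a ^ 2‖ ≠ ‖-(3 * b ^ 2)‖ := by
    rw [hna, hnb, Padic.norm_eq_zpow_neg_valuation ha, Padic.norm_eq_zpow_neg_valuation hb]
    intro h
    have h3 : (3 : ℝ) ≠ 0 := by norm_num
    have h' : ((3 : ℝ) ^ (-a.valuation)) ^ 2 = 3⁻¹ * ((3 : ℝ) ^ (-b.valuation)) ^ 2 := by exact_mod_cast h
    have e1 : ((3 : ℝ) ^ (-a.valuation)) ^ 2 = (3 : ℝ) ^ (-a.valuation * 2) := by
      rw [zpow_mul]; norm_cast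
    have e2 : 3⁻¹ * ((3 : ℝ) ^ (-b.valuation)) ^ 2 = (3 : ℝ) ^ (-b.valuation * 2 - 1) := by
      rw [zpow_sub_one₀ h3, zpow_mul, mul_comm]; norm_cast
    rw [e1, e2] at h'
    have := zpow_right_injective₀ (by norm_num : (0 : ℝ) < 3) (by norm_num : (3 : ℝ) ≠ 1) h'
    omega
  rw [sub_eq_add_neg, Padic.add_eq_max_of_ne hne, hna, hnb]

/-- `3` is not a square in `ℚ₃` (in Mathlib's `QuadraticAlgebra` normal form `r² ≠ a + b r` with `(a, b) = (3, 0)`): the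
hypothesis under which `QuadraticAlgebra ℚ_[3] 3 0 = ℚ₃(√3)` is a field. [folklore] -/
private theorem sq_ne_three (r : ℚ_[3]) : r ^ 2 ≠ 3 + 0 * r := by
  intro h
  have h1 : r ^ 2 - 3 * 1 ^ 2 = 0 := by rw [h]; ring
  have h0 := norm_sq_sub_three_mul_sq r 1
  rw [h1, norm_zero, norm_one] at h0
  have hle : (3⁻¹ : ℝ) * 1 ^ 2 ≤ max (‖r‖ ^ 2) (3⁻¹ * 1 ^ 2) := le_max_right _ _
  rw [← h0] at hle
  norm_num at hle

/-- A value `a² − 3b²` of `3`-adic norm `≤ 1` has `a, b ∈ ℤ₃`. [folklore] -/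
private theorem coords_int_of_norm_le_one {a b : ℚ_[3]} (h : ‖a ^ 2 - 3 * b ^ 2‖ ≤ 1) : ‖a‖ ≤ 1 ∧ ‖b‖ ≤ 1 := by
  rw [norm_sq_sub_three_mul_sq, max_le_iff] at h
  refine ⟨by nlinarith [norm_nonneg a], ?_⟩
  have hb3 : ‖b‖ ^ 2 ≤ 3 := by linarith [h.2]
  have hb : ‖b‖ < (3 : ℝ) := by nlinarith [norm_nonneg b]
  have h2 : ‖b‖ ≤ ((3 : ℕ) : ℝ) ^ (0 : ℤ) :=
    (Padic.norm_le_pow_iff_norm_lt_pow_add_one b 0).2 (by rw [zero_add, zpow_one]; exact_mod_cast hb)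
  rwa [zpow_zero] at h2

/-- **`−1` is not of the form `a² − 3b²`** over `ℚ₃` (a unit value `a² − 3b²` has `a ∈ ℤ₃^×`, `b ∈ ℤ₃`, and is `≡ a² ≡ 1 (mod 3)`,
whereas `−1 ≡ 2`): `−1 ∉ Nm(ℚ₃(√3)^×)`. [folklore] -/
private theorem sq_sub_three_mul_sq_ne_neg_one (a b : ℚ_[3]) : a ^ 2 - 3 * b ^ 2 ≠ -1 := by
  intro h
  obtain ⟨ha, hb⟩ := coords_int_of_norm_le_one (a := a) (b := b) (by rw [h, norm_neg, norm_one])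
  set A : ℤ_[3] := ⟨a, ha⟩ with hA
  set B : ℤ_[3] := ⟨b, hb⟩ with hB
  have h' : A ^ 2 - 3 * B ^ 2 = -1 := PadicInt.ext (by push_cast [hA, hB]; exact h)
  have hr := congrArg PadicInt.toZMod h'
  rw [map_sub, map_mul, map_pow, map_neg, map_one, map_ofNat, map_pow] at hr
  have h3 : (3 : ZMod 3) = 0 := by decide
  rw [h3, zero_mul, sub_zero] at hr
  exact zmod3_sq_ne_two _ (by rw [hr]; decide)

/-- **`3` is not of the form `a² − 3b²`** over `ℚ₃` (`‖a‖² ≤ 3⁻¹` forces `3 ∣ a`, then `3a₁² − b² = 1` gives `b² ≡ −1 (mod 3)`):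
`3 ∉ Nm(ℚ₃(√3)^×)` — while `−3 = Nm(√3)`. [folklore] -/
private theorem sq_sub_three_mul_sq_ne_three (a b : ℚ_[3]) : a ^ 2 - 3 * b ^ 2 ≠ 3 := by
  intro h
  have hn := norm_sq_sub_three_mul_sq a b
  have h3 : ‖(3 : ℚ_[3])‖ = 3⁻¹ := by
    have := Padic.norm_p (p := 3)
    exact_mod_cast this
  rw [h, h3] at hn
  have ha2 : ‖a‖ ^ 2 ≤ 3⁻¹ := (le_max_left _ _).trans_eq hn.symm
  have hb2 : (3⁻¹ : ℝ) * ‖b‖ ^ 2 ≤ 3⁻¹ := (le_max_right _ _).trans_eq hn.symm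
  have hb : ‖b‖ ≤ 1 := by nlinarith [norm_nonneg b]
  have ha : ‖a‖ < 1 := by nlinarith [norm_nonneg a]
  -- `a = 3 a₁` with `a₁ ∈ ℤ₃`
  have ha1 : ‖a / 3‖ ≤ 1 := by
    rw [norm_div, h3, div_le_iff₀ (by norm_num), one_mul]
    have h2 : ‖a‖ ≤ ((3 : ℕ) : ℝ) ^ (-1 : ℤ) :=
      (Padic.norm_le_pow_iff_norm_lt_pow_add_one a (-1)).2 (by rw [neg_add_cancel, zpow_zero]; exact ha)
    rw [zpow_neg_one] at h2
    exact_mod_cast h2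
  set A : ℤ_[3] := ⟨a / 3, ha1⟩ with hA
  set B : ℤ_[3] := ⟨b, hb⟩ with hB
  have c3 : ((3 : ℤ_[3]) : ℚ_[3]) = 3 := rfl
  have h' : 3 * A ^ 2 - B ^ 2 = 1 := PadicInt.ext (by
    push_cast [hA, hB, c3]
    have h3ne : (3 : ℚ_[3]) ≠ 0 := by norm_num
    field_simp
    linear_combination h)
  have hr := congrArg PadicInt.toZMod h'
  rw [map_sub, map_mul, map_pow, map_pow, map_one, map_ofNat] at hr
  have h30 : (3 : ZMod 3) = 0 := by decide
  rw [h30, zero_mul, zero_sub] at hr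
  exact zmod3_sq_ne_two _ (by rw [← neg_neg (PadicInt.toZMod B ^ 2), hr]; decide)

end ThreeAdic

/-! ## §2 `E = ℚ₃(√3)` (Mathlib's `QuadraticAlgebra ℚ_[3] 3 0`, `ω² = 3`): a FIELD with `Nm(a + b√3) = a² − 3b²`; for standing
data with involution `√3 ↦ −√3`, the Step-1 representatives are `b√3` and `−ε ≁ ε`, `3ε ≁ ε`, `−3ε ∼ ε` -/

section Ramified

/-- `Nm(a + b√3) = a² − 3b²` in `ℚ₃(√3)` (Mathlib's `QuadraticAlgebra.norm`). [folklore] -/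
private theorem norm_eq (z : QuadraticAlgebra ℚ_[3] 3 0) : z.norm = z.re ^ 2 - 3 * z.im ^ 2 := by
  rw [QuadraticAlgebra.norm_def]; ring

/-- **`E = ℚ₃(√3)` IS A FIELD** (`3` is not a square in `ℚ₃`): the ramified quadratic extension of `ℚ₃`; the clause
«`E` is a field» of [Liu2021, Lemma D.1 (1)] is TRUE at this datum. [cite: Liu2021, App. D Lemma D.1 (1) (l. 5229)] -/
theorem isField : IsField (QuadraticAlgebra ℚ_[3] 3 0) := by
  haveI : Fact (∀ r : ℚ_[3], r ^ 2 ≠ 3 + 0 * r) := ⟨sq_ne_three⟩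
  exact Field.toIsField _

/-- No element of `ℚ₃(√3)` has norm `−1`. [folklore] -/
private theorem norm_ne_neg_one (x : QuadraticAlgebra ℚ_[3] 3 0) : x.norm ≠ -1 := by
  rw [norm_eq]; exact sq_sub_three_mul_sq_ne_neg_one _ _

/-- No element of `ℚ₃(√3)` has norm `3` … [folklore] -/
private theorem norm_ne_three (x : QuadraticAlgebra ℚ_[3] 3 0) : x.norm ≠ 3 := by
  rw [norm_eq]; exact sq_sub_three_mul_sq_ne_three _ _

/-- … while `√3` has norm `−3`. [folklore] -/
private theorem norm_sqrt_three : (⟨0, 1⟩ : QuadraticAlgebra ℚ_[3] 3 0).norm = -3 := by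
  rw [norm_eq]; norm_num

variable {n : ℕ} {S : OscillatorStandingData ℚ_[3] (QuadraticAlgebra ℚ_[3] 3 0) n}

/-- For standing data on `ℚ₃(√3)` whose involution is `√3 ↦ −√3`: skew elements have zero rational part. [folklore] -/
private theorem re_eq_zero_of_mem_skew (hS : ∀ x, S.conj x = star x) {x : QuadraticAlgebra ℚ_[3] 3 0}
    (hx : x ∈ S.skew) : x.re = 0 := by
  rw [S.mem_skew_iff, hS] at hx
  have h := congrArg QuadraticAlgebra.re hx
  simp only [QuadraticAlgebra.re_add, QuadraticAlgebra.re_star, zero_mul, add_zero, QuadraticAlgebra.re_zero] at h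
  linear_combination h / 2

/-- A representative `ε ∈ E^{−×}` is `b√3` with `b ≠ 0`: its rational part vanishes … [folklore] -/
private theorem epsRep_re (hS : ∀ x, S.conj x = star x) (e : LemD1.EpsRep S) :
    (((e.1 : (QuadraticAlgebra ℚ_[3] 3 0)ˣ)) : QuadraticAlgebra ℚ_[3] 3 0).re = 0 :=
  re_eq_zero_of_mem_skew hS e.2

/-- … and its `√3`-coordinate does not. [folklore] -/
private theorem epsRep_im_ne_zero (hS : ∀ x, S.conj x = star x) (e : LemD1.EpsRep S) :
    (((e.1 : (QuadraticAlgebra ℚ_[3] 3 0)ˣ)) : QuadraticAlgebra ℚ_[3] 3 0).im ≠ 0 := by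
  intro h
  apply e.1.ne_zero
  ext
  · rw [epsRep_re hS e]; rfl
  · rw [h]; rfl

/-- `x x^c · ε = (0, Nm(x) b)` for `ε = b√3`. [folklore] -/
private theorem mul_star_mul_epsRep (hS : ∀ x, S.conj x = star x) (e : LemD1.EpsRep S)
    (x : QuadraticAlgebra ℚ_[3] 3 0) :
    x * star x * ((e.1 : (QuadraticAlgebra ℚ_[3] 3 0)ˣ) : QuadraticAlgebra ℚ_[3] 3 0) =
      ⟨0, x.norm * (((e.1 : (QuadraticAlgebra ℚ_[3] 3 0)ˣ)) : QuadraticAlgebra ℚ_[3] 3 0).im⟩ := by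
  rw [← QuadraticAlgebra.algebraMap_norm_eq_mul_star, QuadraticAlgebra.algebraMap_eq]
  have hre := epsRep_re hS e
  ext
  · simp [QuadraticAlgebra.re_mul, hre]
  · simp [QuadraticAlgebra.im_mul, hre]

/-- **Two representatives `ε = b√3`, `ε' = b'√3` are in the same class iff `b'/b` is a norm**: if `SameClass ε ε'` (READING L3′:
`ε' = x x^c ε` for a unit `x`) then `b' = Nm(x) · b`. [cite: Liu2021, App. D §D.1 Step 1 (l. 5217)] -/
theorem exists_norm_eq_of_sameClass (hS : ∀ x, S.conj x = star x) {e e' : LemD1.EpsRep S} (h : LemD1.SameClass e e') :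
    ∃ x : QuadraticAlgebra ℚ_[3] 3 0, x.norm * (((e.1 : (QuadraticAlgebra ℚ_[3] 3 0)ˣ)) : QuadraticAlgebra ℚ_[3] 3 0).im =
      (((e'.1 : (QuadraticAlgebra ℚ_[3] 3 0)ˣ)) : QuadraticAlgebra ℚ_[3] 3 0).im := by
  obtain ⟨x, hx⟩ := h
  refine ⟨x, ?_⟩
  have hx' := congrArg (fun u : (QuadraticAlgebra ℚ_[3] 3 0)ˣ => (u : QuadraticAlgebra ℚ_[3] 3 0).im) hx
  simp only [Units.val_mul, Units.coe_map, MonoidHom.coe_coe, OscillatorStandingData.σ_apply, hS] at hx'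
  rw [mul_star_mul_epsRep hS e] at hx'
  exact hx'.symm

/-- **THE FLIP `ε ↦ −ε` CHANGES THE CLASS at the ramified place**: for EVERY Step-1 representative `ε ∈ E^{−×}` over
`ℚ₃(√3)/ℚ₃` (involution `√3 ↦ −√3`), the representative `−ε` of [Liu2021, Lemma D.1 (2)] (tree `LemD1.epsNeg ε`) is NOT in the
class of `ε` in `E^{−×}/Nm_{E/F} E^×` — because `−1` is not a norm from `ℚ₃(√3)`.  Contrast: at the unramified place `ℚ₃(i)/ℚ₃`
(`LemD1AsPrintedIndexedNonVacuityNonsplit.lean`, `sameClass_iff`) `−ε ∼ ε` always. [cite: Liu2021, App. D Lemma D.1 (2) (l. 5231)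
and §D.1 Step 1 (l. 5217)] -/
theorem not_sameClass_epsNeg (hS : ∀ x, S.conj x = star x) (e : LemD1.EpsRep S) : ¬ LemD1.SameClass e (LemD1.epsNeg e) := by
  intro h
  obtain ⟨x, hx⟩ := exists_norm_eq_of_sameClass hS h
  have him := epsRep_im_ne_zero hS e
  have hneg : (((LemD1.epsNeg e).1 : (QuadraticAlgebra ℚ_[3] 3 0)ˣ) : QuadraticAlgebra ℚ_[3] 3 0).im =
      -(((e.1 : (QuadraticAlgebra ℚ_[3] 3 0)ˣ)) : QuadraticAlgebra ℚ_[3] 3 0).im := by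
    change (((-e.1 : (QuadraticAlgebra ℚ_[3] 3 0)ˣ)) : QuadraticAlgebra ℚ_[3] 3 0).im = _
    rw [Units.val_neg, QuadraticAlgebra.im_neg]
  rw [hneg] at hx
  have hN : x.norm = -1 := by
    have := mul_right_cancel₀ him (hx.trans (neg_one_mul _).symm)
    exact this
  exact norm_ne_neg_one x hN

/-- `3ε ≁ ε` as well (`3` is not a norm from `ℚ₃(√3)`). [cite: Liu2021, App. D §D.1 Step 1 (l. 5217)] -/
theorem not_sameClass_of_eq_three_mul (hS : ∀ x, S.conj x = star x) (e e' : LemD1.EpsRep S)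
    (h3 : (((e'.1 : (QuadraticAlgebra ℚ_[3] 3 0)ˣ)) : QuadraticAlgebra ℚ_[3] 3 0) =
      3 * (((e.1 : (QuadraticAlgebra ℚ_[3] 3 0)ˣ)) : QuadraticAlgebra ℚ_[3] 3 0)) :
    ¬ LemD1.SameClass e e' := by
  intro h
  obtain ⟨x, hx⟩ := exists_norm_eq_of_sameClass hS h
  have him := epsRep_im_ne_zero hS e
  have h3' : (((e'.1 : (QuadraticAlgebra ℚ_[3] 3 0)ˣ)) : QuadraticAlgebra ℚ_[3] 3 0).im =
      3 * (((e.1 : (QuadraticAlgebra ℚ_[3] 3 0)ˣ)) : QuadraticAlgebra ℚ_[3] 3 0).im := by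
    rw [h3, QuadraticAlgebra.im_mul]
    simp [QuadraticAlgebra.re_ofNat, QuadraticAlgebra.im_ofNat]
  rw [h3'] at hx
  exact norm_ne_three x (mul_right_cancel₀ him hx)

/-- … whereas `−3ε ∼ ε` (`−3 = Nm(√3) = √3 · (√3)^c`): so `[3ε] = [−ε] ≠ [ε]`. [cite: Liu2021, App. D §D.1 Step 1 (l. 5217)] -/
theorem sameClass_of_eq_neg_three_mul (hS : ∀ x, S.conj x = star x) (e e' : LemD1.EpsRep S)
    (h3 : (((e'.1 : (QuadraticAlgebra ℚ_[3] 3 0)ˣ)) : QuadraticAlgebra ℚ_[3] 3 0) =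
      -3 * (((e.1 : (QuadraticAlgebra ℚ_[3] 3 0)ˣ)) : QuadraticAlgebra ℚ_[3] 3 0)) :
    LemD1.SameClass e e' := by
  haveI : Fact (∀ r : ℚ_[3], r ^ 2 ≠ 3 + 0 * r) := ⟨sq_ne_three⟩
  have hω : (⟨0, 1⟩ : QuadraticAlgebra ℚ_[3] 3 0) ≠ 0 := fun h => by
    have := congrArg QuadraticAlgebra.im h
    norm_num at this
  refine ⟨Units.mk0 _ hω, Units.ext ?_⟩
  simp only [Units.val_mul, Units.coe_map, MonoidHom.coe_coe, OscillatorStandingData.σ_apply, hS, Units.val_mk0]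
  rw [h3, ← QuadraticAlgebra.algebraMap_norm_eq_mul_star, norm_sqrt_three, QuadraticAlgebra.algebraMap_eq]
  ext <;> simp [QuadraticAlgebra.re_ofNat, QuadraticAlgebra.im_ofNat]

end Ramified

/-! ## §3 The standing data exist at the ramified place (so §2 is not vacuous) -/

section StandingData

/-- **The standing data of [Liu2021, §D.1] at the RAMIFIED place**: `F = ℚ₃` (non-archimedean local field of characteristic
`0 ≠ 2`), `E = ℚ₃(√3)` with `c : √3 ↦ −√3` (Mathlib's `star`; étale of rank `2`, a separable quadratic FIELD extension), Gram
matrix `1`, any rank `n ≥ 2`. [cite: Liu2021, App. D §D.1 (l. 5213)] -/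
theorem exists_standingData (n : ℕ) (hn : 2 ≤ n) :
    ∃ S : OscillatorStandingData ℚ_[3] (QuadraticAlgebra ℚ_[3] 3 0) n, (∀ x, S.conj x = star x) ∧ S.gram = 1 := by
  haveI hF : Fact (∀ r : ℚ_[3], r ^ 2 ≠ 3 + 0 * r) := ⟨sq_ne_three⟩
  let c : QuadraticAlgebra ℚ_[3] 3 0 ≃ₐ[ℚ_[3]] QuadraticAlgebra ℚ_[3] 3 0 :=
    AlgEquiv.ofRingEquiv (f := (starRingAut : RingAut (QuadraticAlgebra ℚ_[3] 3 0))) fun r => by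
      change star (algebraMap ℚ_[3] (QuadraticAlgebra ℚ_[3] 3 0) r) = _
      rw [QuadraticAlgebra.algebraMap_eq]
      ext <;> simp [QuadraticAlgebra.star_mk]
  have hc : ∀ x, c x = star x := fun x => rfl
  haveI : Algebra.IsIntegral ℚ_[3] (QuadraticAlgebra ℚ_[3] 3 0) := Algebra.IsIntegral.of_finite _ _
  refine ⟨{ conj := c
            conj_conj := fun x => by rw [hc, hc, star_star]
            conj_ne_refl := fun h => by
              have := DFunLike.congr_fun h (⟨0, 1⟩ : QuadraticAlgebra ℚ_[3] 3 0)
              rw [hc, QuadraticAlgebra.star_mk, AlgEquiv.coe_refl, id] at this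
              have := congrArg QuadraticAlgebra.im this
              norm_num at this
            gram := 1
            gram_hermitian := by rw [Matrix.map_one _ (map_zero c) (map_one c), Matrix.transpose_one]
            isUnit_det_gram := by simp
            ringChar_ne_two := by rw [ringChar.eq_zero]; decide
            formallyEtale := Algebra.FormallyEtale.of_isSeparable ℚ_[3] (QuadraticAlgebra ℚ_[3] 3 0)
            finrank_eq_two := QuadraticAlgebra.finrank_eq_two 3 0
            two_le := hn }, hc, rfl⟩

/-- **Non-vacuity of §2**: at the ramified datum (any rank `n ≥ 2`) there IS a Step-1 representative `ε = √3`, and `−ε`, `ε` lie in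
different classes of `E^{−×}/Nm_{E/F} E^×`, `3ε` in the class of `−ε`.  So the tree's reading of «`ε' = ε`» in
`E^{−×}/Nm_{E/F}E^×` (READING L3′) distinguishes `ε` from the `−ε` of items (2)/(4) at some honest datum.
[cite: Liu2021, App. D Lemma D.1 (2) (l. 5231), (4) (l. 5235); §D.1 Step 1 (l. 5217)] -/
theorem exists_epsRep_not_sameClass_epsNeg (n : ℕ) (hn : 2 ≤ n) :
    ∃ (S : OscillatorStandingData ℚ_[3] (QuadraticAlgebra ℚ_[3] 3 0) n) (e e₃ : LemD1.EpsRep S),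
      IsField (QuadraticAlgebra ℚ_[3] 3 0) ∧ (∀ x, S.conj x = star x) ∧
      (((e.1 : (QuadraticAlgebra ℚ_[3] 3 0)ˣ)) : QuadraticAlgebra ℚ_[3] 3 0) = ⟨0, 1⟩ ∧
      ¬ LemD1.SameClass e (LemD1.epsNeg e) ∧
      (((e₃.1 : (QuadraticAlgebra ℚ_[3] 3 0)ˣ)) : QuadraticAlgebra ℚ_[3] 3 0) = ⟨0, 3⟩ ∧
      ¬ LemD1.SameClass e e₃ ∧ LemD1.SameClass (LemD1.epsNeg e) e₃ := by
  haveI hF : Fact (∀ r : ℚ_[3], r ^ 2 ≠ 3 + 0 * r) := ⟨sq_ne_three⟩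
  obtain ⟨S, hS, -⟩ := exists_standingData n hn
  have hskew : ∀ b : ℚ_[3], (⟨0, b⟩ : QuadraticAlgebra ℚ_[3] 3 0) ∈ S.skew := fun b => by
    rw [S.mem_skew_iff, hS, QuadraticAlgebra.star_mk]
    ext <;> simp
  have hne : ∀ b : ℚ_[3], b ≠ 0 → (⟨0, b⟩ : QuadraticAlgebra ℚ_[3] 3 0) ≠ 0 := fun b hb h =>
    hb (by simpa using congrArg QuadraticAlgebra.im h)
  let eb : ∀ b : ℚ_[3], b ≠ 0 → LemD1.EpsRep S := fun b hb =>
    ⟨Units.mk0 _ (hne b hb), by rw [Units.val_mk0]; exact hskew b⟩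
  have h3 : (3 : ℚ_[3]) ≠ 0 := by norm_num
  refine ⟨S, eb 1 one_ne_zero, eb 3 h3, isField, hS, rfl, not_sameClass_epsNeg hS _, rfl,
    not_sameClass_of_eq_three_mul hS _ _ ?_, sameClass_of_eq_neg_three_mul hS _ _ ?_⟩
  · change (⟨0, 3⟩ : QuadraticAlgebra ℚ_[3] 3 0) = 3 * ⟨0, 1⟩
    ext <;> simp [QuadraticAlgebra.re_ofNat, QuadraticAlgebra.im_ofNat]
  · change (⟨0, 3⟩ : QuadraticAlgebra ℚ_[3] 3 0) = -3 * ((-(Units.mk0 _ (hne 1 one_ne_zero)) :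
      (QuadraticAlgebra ℚ_[3] 3 0)ˣ) : QuadraticAlgebra ℚ_[3] 3 0)
    rw [Units.val_neg, Units.val_mk0]
    ext <;> simp [QuadraticAlgebra.re_ofNat, QuadraticAlgebra.im_ofNat]

end StandingData

/-! ## §4 Step 2 at the ramified place: a character `μ` of `E^×` with `μ|_{ℚ₃^×}` of kernel EXACTLY `Nm E^×`
(`μ = I^{ord_E} · (unit part mod 𝔭 | 3)`: `μ(√3) = I`, order `4`) -/

section StepTwo

/-- Elements of `ℚ₃` of the same norm have the same valuation. [folklore] -/
private theorem valuation_eq_of_norm_eq {y y₀ : ℚ_[3]} (hy : y ≠ 0) (hy₀ : y₀ ≠ 0) (h : ‖y‖ = ‖y₀‖) :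
    y.valuation = y₀.valuation := by
  have h3pos : (0 : ℝ) < ((3 : ℕ) : ℝ) := by norm_num
  have h3ne1 : ((3 : ℕ) : ℝ) ≠ 1 := by norm_num
  rw [Padic.norm_eq_zpow_neg_valuation hy, Padic.norm_eq_zpow_neg_valuation hy₀] at h
  have := zpow_right_injective₀ h3pos h3ne1 h
  omega

/-- The valuation is locally constant off `0`: `‖y − y₀‖ < ‖y₀‖` forces `ord y = ord y₀`. [folklore] -/
private theorem valuation_eq_of_norm_sub_lt {y y₀ : ℚ_[3]} (hy₀ : y₀ ≠ 0) (h : ‖y - y₀‖ < ‖y₀‖) :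
    y.valuation = y₀.valuation := by
  have hn : ‖y‖ = ‖y₀‖ :=
    Literature.NumberTheory.QuadraticForms.padic_norm_eq_of_norm_sub_lt (by rwa [norm_sub_rev])
  have hy : y ≠ 0 := fun h0 => by
    rw [h0, norm_zero] at hn
    exact hy₀ (norm_eq_zero.1 hn.symm)
  exact valuation_eq_of_norm_eq hy hy₀ hn

/-- In `𝔽₃^× = {1, 2}`: the exponent of the Legendre symbol (`1 ↦ 0`, `2 ↦ 1` in `ℤ/2`) is additive. [folklore] -/
private theorem zmod3_legendre_exp : ∀ x y : ZMod 3, x ≠ 0 → y ≠ 0 →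
    (if x * y = 2 then (1 : ZMod 2) else 0) = (if x = 2 then (1 : ZMod 2) else 0) + (if y = 2 then (1 : ZMod 2) else 0) := by
  decide

/-- In `𝔽₃`: a non-zero element squares to `1`. [folklore] -/
private theorem zmod3_mul_self_eq_one : ∀ x : ZMod 3, x ≠ 0 → x * x = 1 := by decide

/-- A unit of `ℚ₃(√3)` — an element whose norm `a² − 3b²` is a `3`-adic unit — has `a ∈ ℤ₃^×` and `b ∈ ℤ₃`. [folklore] -/
private theorem coords_of_norm_norm_eq_one {a b : ℚ_[3]} (h : ‖a ^ 2 - 3 * b ^ 2‖ = 1) :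
    ‖a‖ ≤ 1 ∧ ‖b‖ ≤ 1 ∧ ‖a‖ = 1 := by
  obtain ⟨ha, hb⟩ := coords_int_of_norm_le_one (a := a) (b := b) h.le
  refine ⟨ha, hb, ?_⟩
  rw [norm_sq_sub_three_mul_sq] at h
  by_contra hne
  have hlt : ‖a‖ < 1 := lt_of_le_of_ne ha hne
  have ha2 : ‖a‖ ^ 2 < 1 := by nlinarith [norm_nonneg a]
  have hb2 : 3⁻¹ * ‖b‖ ^ 2 < 1 := by nlinarith [norm_nonneg b]
  have : max (‖a‖ ^ 2) (3⁻¹ * ‖b‖ ^ 2) < 1 := max_lt ha2 hb2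
  linarith

variable {n : ℕ} {S : OscillatorStandingData ℚ_[3] (QuadraticAlgebra ℚ_[3] 3 0) n}
  [TopologicalSpace (QuadraticAlgebra ℚ_[3] 3 0)] [IsModuleTopology ℚ_[3] (QuadraticAlgebra ℚ_[3] 3 0)]

/-- the coordinate `re : ℚ₃(√3) → ℚ₃` is continuous for the module topology. [folklore] -/
private theorem continuous_re : Continuous fun z : QuadraticAlgebra ℚ_[3] 3 0 => z.re :=
  IsModuleTopology.continuous_of_linearMap (QuadraticAlgebra.reₗ (R := ℚ_[3]) (a := 3) (b := 0))

/-- the coordinate `im : ℚ₃(√3) → ℚ₃` is continuous for the module topology. [folklore] -/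
private theorem continuous_im : Continuous fun z : QuadraticAlgebra ℚ_[3] 3 0 => z.im :=
  IsModuleTopology.continuous_of_linearMap (QuadraticAlgebra.imₗ (R := ℚ_[3]) (a := 3) (b := 0))

omit [IsModuleTopology ℚ_[3] (QuadraticAlgebra ℚ_[3] 3 0)] in
/-- **At the ramified place EVERY Step-2 character has `μ(3) = −1`** (so `μ(√3)² = −1` and `μ` has order divisible by `4`):
the printed clause «`μ|_{F^×}` is the unique character whose kernel is exactly `Nm_{E/F} E^×`» applied to `a = 3 ∉ Nm E^×`
(`norm_ne_three`) and to `a = 9 = Nm(3)`. [cite: Liu2021, App. D §D.1 Step 2 (l. 5219)] -/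
theorem muSet_apply_three (hS : ∀ x, S.conj x = star x) (μ : LemD1.MuSet S) :
    μ.1 (Units.map (algebraMap ℚ_[3] (QuadraticAlgebra ℚ_[3] 3 0)).toMonoidHom (Units.mk0 (3 : ℚ_[3]) (by norm_num))) = -1 := by
  haveI hF : Fact (∀ r : ℚ_[3], r ^ 2 ≠ 3 + 0 * r) := ⟨sq_ne_three⟩
  set a3 : ℚ_[3]ˣ := Units.mk0 (3 : ℚ_[3]) (by norm_num) with ha3
  have hne : μ.1 (Units.map (algebraMap ℚ_[3] (QuadraticAlgebra ℚ_[3] 3 0)).toMonoidHom a3) ≠ 1 := by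
    rw [Ne, μ.2.2.2 a3]
    rintro ⟨x, hx⟩
    rw [hS, ← QuadraticAlgebra.algebraMap_norm_eq_mul_star, ha3, Units.val_mk0] at hx
    exact norm_ne_three x (QuadraticAlgebra.algebraMap_injective hx)
  have hsq : μ.1 (Units.map (algebraMap ℚ_[3] (QuadraticAlgebra ℚ_[3] 3 0)).toMonoidHom a3) ^ 2 = 1 := by
    rw [← map_pow, ← map_pow, μ.2.2.2 (a3 ^ 2)]
    refine ⟨Units.map (algebraMap ℚ_[3] (QuadraticAlgebra ℚ_[3] 3 0)).toMonoidHom a3, ?_⟩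
    have hfix : S.conj (algebraMap ℚ_[3] (QuadraticAlgebra ℚ_[3] 3 0) (a3 : ℚ_[3])) =
        algebraMap ℚ_[3] (QuadraticAlgebra ℚ_[3] 3 0) (a3 : ℚ_[3]) := S.conj.commutes _
    have hza : ((Units.map (algebraMap ℚ_[3] (QuadraticAlgebra ℚ_[3] 3 0)).toMonoidHom a3 :
        (QuadraticAlgebra ℚ_[3] 3 0)ˣ) : QuadraticAlgebra ℚ_[3] 3 0) = algebraMap ℚ_[3] (QuadraticAlgebra ℚ_[3] 3 0) a3 := rfl
    rw [hza, hfix, Units.val_pow_eq_pow_val, map_pow, pow_two]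
  -- a unit of `ℂ` with square `1` and `≠ 1` is `−1`
  have h := congrArg (fun u : ℂˣ => (u : ℂ)) hsq
  simp only [Units.val_pow_eq_pow_val, Units.val_one] at h
  rw [pow_two] at h
  rcases mul_self_eq_one_iff.1 h with h1 | h1
  · exact absurd (Units.ext h1) hne
  · exact Units.ext h1

/-- **A Step-2 character EXISTS at the ramified datum** (so `MuSet S` is inhabited and the Step-2 clause is non-degenerate in
the ramified direction too): `μ(z) := I^{k} · (a₀ | 3)` where `k = ord₃ Nm(z)` (`= ord_E z`, the valuation for the uniformiser
`√3`), `z · (√3)^{−k} = a₀ + b₀√3` is the unit part (`a₀ ∈ ℤ₃^×`, `b₀ ∈ ℤ₃`), and `( | 3)` the Legendre symbol of `a₀ mod 3` — a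
homomorphism because `re((a₀ + b₀√3)(a₀' + b₀'√3)) = a₀a₀' + 3 b₀ b₀' ≡ a₀ a₀' (mod 3)`.  It is unitary, continuous (locally
constant), and `μ|_{ℚ₃^×}(t) = (−1)^{ord₃ t} · (t 3^{−ord₃ t} | 3)` has kernel EXACTLY `Nm E^× = {t : t·(−3)^{−ord₃ t} ≡ 1 (mod 3)}`
(`⊆`: a unit square is `≡ 1`; `⊇`: Hensel via the tree's `padicInt_isSquare_of_toZMod_eq_one`, and `−3 = Nm(√3)`).
(The bare statement `Nonempty (MuSet S)` is kept file-private — it has the same shape as the unramified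
`LemD1IndexedNonVacuityNonsplit.nonempty_muSet` over a different `E` —; the public form is `exists_muSet_sq_sqrt_three` below.)
[cite: Liu2021, App. D §D.1 Step 2 (l. 5219)] -/
private theorem nonempty_muSet_ramified (hS : ∀ x, S.conj x = star x) : Nonempty (LemD1.MuSet S) := by
  classical
  haveI hF : Fact (∀ r : ℚ_[3], r ^ 2 ≠ 3 + 0 * r) := ⟨sq_ne_three⟩
  -- the uniformiser `√3` and the norm on units
  have hω0 : (⟨0, 1⟩ : QuadraticAlgebra ℚ_[3] 3 0) ≠ 0 := fun h => by
    have := congrArg QuadraticAlgebra.im h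
    norm_num at this
  let ωu : (QuadraticAlgebra ℚ_[3] 3 0)ˣ := Units.mk0 _ hω0
  have hωu : ((ωu : (QuadraticAlgebra ℚ_[3] 3 0)ˣ) : QuadraticAlgebra ℚ_[3] 3 0) = ⟨0, 1⟩ := rfl
  let Nu : (QuadraticAlgebra ℚ_[3] 3 0)ˣ →* ℚ_[3]ˣ := Units.map (QuadraticAlgebra.norm (R := ℚ_[3]) (a := 3) (b := 0))
  have hNu : ∀ z, ((Nu z : ℚ_[3]ˣ) : ℚ_[3]) = (z : QuadraticAlgebra ℚ_[3] 3 0).norm := fun z => rfl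
  have hNuω : ((Nu ωu : ℚ_[3]ˣ) : ℚ_[3]) = -3 := by rw [hNu, hωu, norm_sqrt_three]
  -- `k(z) = ord₃ Nm(z)`
  let kf : (QuadraticAlgebra ℚ_[3] 3 0)ˣ → ℤ := fun z => ((Nu z : ℚ_[3]ˣ) : ℚ_[3]).valuation
  have hkf : ∀ z, kf z = ((Nu z : ℚ_[3]ˣ) : ℚ_[3]).valuation := fun z => rfl
  have hk_mul : ∀ z w, kf (z * w) = kf z + kf w := fun z w => by
    rw [hkf, hkf, hkf, map_mul, Units.val_mul, Padic.valuation_mul (Units.ne_zero _) (Units.ne_zero _)]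
  have hk_one : kf 1 = 0 := by rw [hkf, map_one, Units.val_one, Padic.valuation_one]
  have h3ne : (3 : ℚ_[3]) ≠ 0 := by norm_num
  have hv3 : (3 : ℚ_[3]).valuation = 1 := by rw [Padic.valuation_ofNat]; simp
  have hvm3 : (-3 : ℚ_[3]).valuation = 1 :=
    (valuation_eq_of_norm_eq (neg_ne_zero.2 h3ne) h3ne (norm_neg _)).trans hv3
  have hkω : kf ωu = 1 := by rw [hkf, hNuω, hvm3]
  have hk_zpow : ∀ j : ℤ, kf (ωu ^ j) = j := fun j => by
    rw [hkf, map_zpow, Units.val_zpow_eq_zpow_val, Padic.valuation_zpow, ← hkf, hkω, mul_one]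
  have hk_inv : ∀ z, kf z⁻¹ = -kf z := fun z => by
    rw [hkf, map_inv, Units.val_inv_eq_inv_val, Padic.valuation_inv, ← hkf]
  -- the unit part `w(z) = z · (√3)^{−k(z)}`
  let wu : (QuadraticAlgebra ℚ_[3] 3 0)ˣ → (QuadraticAlgebra ℚ_[3] 3 0)ˣ := fun z => z * (ωu ^ kf z)⁻¹
  have hwu : ∀ z, wu z = z * (ωu ^ kf z)⁻¹ := fun z => rfl
  have hw_mul : ∀ z w, wu (z * w) = wu z * wu w := fun z w => by
    rw [hwu, hwu, hwu, hk_mul, zpow_add, mul_inv, mul_mul_mul_comm]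
  have hk_w : ∀ z, kf (wu z) = 0 := fun z => by rw [hwu, hk_mul, hk_inv, hk_zpow]; ring
  have hN_w : ∀ z, ‖((wu z : (QuadraticAlgebra ℚ_[3] 3 0)ˣ) : QuadraticAlgebra ℚ_[3] 3 0).norm‖ = 1 := fun z => by
    rw [← hNu, Padic.norm_eq_zpow_neg_valuation (Units.ne_zero _), ← hkf, hk_w, neg_zero, zpow_zero]
  have hco : ∀ z, ‖((wu z : (QuadraticAlgebra ℚ_[3] 3 0)ˣ) : QuadraticAlgebra ℚ_[3] 3 0).re‖ ≤ 1 ∧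
      ‖((wu z : (QuadraticAlgebra ℚ_[3] 3 0)ˣ) : QuadraticAlgebra ℚ_[3] 3 0).im‖ ≤ 1 ∧
      ‖((wu z : (QuadraticAlgebra ℚ_[3] 3 0)ˣ) : QuadraticAlgebra ℚ_[3] 3 0).re‖ = 1 := fun z =>
    coords_of_norm_norm_eq_one (by rw [← norm_eq]; exact hN_w z)
  let R : (QuadraticAlgebra ℚ_[3] 3 0)ˣ → ℤ_[3] := fun z => ⟨_, (hco z).1⟩
  let Im : (QuadraticAlgebra ℚ_[3] 3 0)ˣ → ℤ_[3] := fun z => ⟨_, (hco z).2.1⟩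
  have hR : ∀ z, ((R z : ℤ_[3]) : ℚ_[3]) = ((wu z : (QuadraticAlgebra ℚ_[3] 3 0)ˣ) : QuadraticAlgebra ℚ_[3] 3 0).re :=
    fun z => rfl
  have hIm : ∀ z, ((Im z : ℤ_[3]) : ℚ_[3]) = ((wu z : (QuadraticAlgebra ℚ_[3] 3 0)ˣ) : QuadraticAlgebra ℚ_[3] 3 0).im :=
    fun z => rfl
  have c3 : ((3 : ℤ_[3]) : ℚ_[3]) = 3 := rfl
  have hR_mul : ∀ z w, R (z * w) = R z * R w + 3 * (Im z * Im w) := fun z w => PadicInt.ext (by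
    push_cast [hR, hIm, c3]
    rw [hw_mul, Units.val_mul, QuadraticAlgebra.re_mul]
    ring)
  have hRne : ∀ z, PadicInt.toZMod (R z) ≠ 0 := fun z => by
    rw [Ne, toZMod_eq_zero_iff, not_lt]
    exact (hco z).2.2.ge
  have h30 : (3 : ZMod 3) = 0 := by decide
  have hR_red : ∀ z w, PadicInt.toZMod (R (z * w)) = PadicInt.toZMod (R z) * PadicInt.toZMod (R w) := fun z w => by
    rw [hR_mul, map_add, map_mul, map_mul, map_ofNat, h30, zero_mul, add_zero]
  -- the Legendre exponent of the unit part
  let κ : (QuadraticAlgebra ℚ_[3] 3 0)ˣ → ZMod 2 := fun z => if PadicInt.toZMod (R z) = 2 then 1 else 0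
  have hκ : ∀ z, κ z = if PadicInt.toZMod (R z) = 2 then 1 else 0 := fun z => rfl
  have hκ_mul : ∀ z w, κ (z * w) = κ z + κ w := fun z w => by
    rw [hκ, hκ, hκ, hR_red]
    exact zmod3_legendre_exp _ _ (hRne z) (hRne w)
  have hpow : ∀ a b : ZMod 2, (-1 : ℂˣ) ^ (a + b).val = (-1) ^ a.val * (-1) ^ b.val := fun a b => by
    rw [← pow_add, ZMod.val_add]
    conv_rhs => rw [← Nat.div_add_mod (a.val + b.val) 2, pow_add, pow_mul, neg_one_sq, one_pow, one_mul]
  have hR1 : PadicInt.toZMod (R 1) = 1 := by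
    have h : R 1 = 1 := PadicInt.ext (by
      rw [hR, hwu, hk_one, zpow_zero, inv_one, mul_one, Units.val_one, PadicInt.coe_one]
      exact QuadraticAlgebra.re_one)
    rw [h, map_one]
  let μ₂ : (QuadraticAlgebra ℚ_[3] 3 0)ˣ →* ℂˣ :=
    { toFun := fun z => (-1) ^ (κ z).val
      map_one' := by
        rw [hκ, hR1, if_neg (by decide), ZMod.val_zero, pow_zero]
      map_mul' := fun z w => by simp only [hκ_mul, hpow] }
  -- the unit `I` and `μ₁ = I^{k}`
  let uI : ℂˣ := Units.mk0 Complex.I Complex.I_ne_zero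
  have huI : ((uI : ℂˣ) : ℂ) = Complex.I := rfl
  have huI2 : uI ^ (2 : ℤ) = -1 := by
    apply Units.ext
    rw [Units.val_zpow_eq_zpow_val, huI, zpow_two, Complex.I_mul_I, Units.val_neg, Units.val_one]
  let μ₁ : (QuadraticAlgebra ℚ_[3] 3 0)ˣ →* ℂˣ :=
    { toFun := fun z => uI ^ kf z
      map_one' := by rw [hk_one, zpow_zero]
      map_mul' := fun z w => by rw [hk_mul, zpow_add] }
  let μ : (QuadraticAlgebra ℚ_[3] 3 0)ˣ →* ℂˣ := μ₁ * μ₂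
  have hμ : ∀ z, μ z = uI ^ kf z * (-1) ^ (κ z).val := fun z => rfl
  -- continuity ingredients
  have hcN : Continuous fun z : (QuadraticAlgebra ℚ_[3] 3 0)ˣ => ((Nu z : ℚ_[3]ˣ) : ℚ_[3]) := by
    have h1 : Continuous fun z : (QuadraticAlgebra ℚ_[3] 3 0)ˣ =>
        (z : QuadraticAlgebra ℚ_[3] 3 0).re ^ 2 - 3 * (z : QuadraticAlgebra ℚ_[3] 3 0).im ^ 2 :=
      ((continuous_re.comp Units.continuous_val).pow 2).sub
        (continuous_const.mul ((continuous_im.comp Units.continuous_val).pow 2))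
    refine h1.congr fun z => ?_
    rw [hNu, norm_eq]
  refine ⟨⟨μ, fun z => ?_, ?_, fun a => ?_⟩⟩
  · -- unitary
    rw [hμ, Units.val_mul, norm_mul, Units.val_zpow_eq_zpow_val, norm_zpow, huI, Complex.norm_I, one_zpow, one_mul,
      Units.val_pow_eq_pow_val, norm_pow, Units.val_neg, Units.val_one, norm_neg, norm_one, one_pow]
  · -- continuous: locally constant
    refine continuous_iff_continuousAt.2 fun z₀ => ?_
    have h0 : ((Nu z₀ : ℚ_[3]ˣ) : ℚ_[3]) ≠ 0 := Units.ne_zero _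
    have hev_k : ∀ᶠ z : (QuadraticAlgebra ℚ_[3] 3 0)ˣ in nhds z₀, kf z = kf z₀ := by
      have hball : Metric.ball ((Nu z₀ : ℚ_[3]ˣ) : ℚ_[3]) ‖((Nu z₀ : ℚ_[3]ˣ) : ℚ_[3])‖ ∈
          nhds ((Nu z₀ : ℚ_[3]ˣ) : ℚ_[3]) :=
        Metric.ball_mem_nhds _ (norm_pos_iff.2 h0)
      filter_upwards [hcN.continuousAt.preimage_mem_nhds hball] with z hz
      exact valuation_eq_of_norm_sub_lt h0 (by simpa [dist_eq_norm] using hz)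
    -- on `{k = k₀}`, `w(z) = z · C` for the constant `C = (√3)^{−k₀}`
    set C : (QuadraticAlgebra ℚ_[3] 3 0)ˣ := (ωu ^ kf z₀)⁻¹ with hC
    have hcg : Continuous fun z : (QuadraticAlgebra ℚ_[3] 3 0)ˣ =>
        ((z : QuadraticAlgebra ℚ_[3] 3 0) * (C : QuadraticAlgebra ℚ_[3] 3 0)).re := by
      have h1 : Continuous fun z : (QuadraticAlgebra ℚ_[3] 3 0)ˣ =>
          (z : QuadraticAlgebra ℚ_[3] 3 0).re * (C : QuadraticAlgebra ℚ_[3] 3 0).re +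
            3 * (z : QuadraticAlgebra ℚ_[3] 3 0).im * (C : QuadraticAlgebra ℚ_[3] 3 0).im :=
        ((continuous_re.comp Units.continuous_val).mul continuous_const).add
          ((continuous_const.mul (continuous_im.comp Units.continuous_val)).mul continuous_const)
      refine h1.congr fun z => ?_
      rw [QuadraticAlgebra.re_mul]
    have hev_g : ∀ᶠ z : (QuadraticAlgebra ℚ_[3] 3 0)ˣ in nhds z₀,
        ‖((z : QuadraticAlgebra ℚ_[3] 3 0) * (C : QuadraticAlgebra ℚ_[3] 3 0)).re -
          ((z₀ : QuadraticAlgebra ℚ_[3] 3 0) * (C : QuadraticAlgebra ℚ_[3] 3 0)).re‖ < 1 := by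
      refine (isOpen_lt (continuous_norm.comp (hcg.sub continuous_const)) continuous_const).mem_nhds ?_
      simp only [Set.mem_setOf_eq, Function.comp_apply, Pi.sub_apply, sub_self, norm_zero, zero_lt_one]
    refine (continuousAt_const (y := ((μ z₀ : ℂˣ) : ℂ))).congr ((hev_k.and hev_g).mono fun z hz => ?_)
    obtain ⟨hz1, hz2⟩ := hz
    have hwz : ((wu z : (QuadraticAlgebra ℚ_[3] 3 0)ˣ) : QuadraticAlgebra ℚ_[3] 3 0) =
        (z : QuadraticAlgebra ℚ_[3] 3 0) * (C : QuadraticAlgebra ℚ_[3] 3 0) := by rw [hwu, hz1, hC, Units.val_mul]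
    have hwz₀ : ((wu z₀ : (QuadraticAlgebra ℚ_[3] 3 0)ˣ) : QuadraticAlgebra ℚ_[3] 3 0) =
        (z₀ : QuadraticAlgebra ℚ_[3] 3 0) * (C : QuadraticAlgebra ℚ_[3] 3 0) := by rw [hwu, hC, Units.val_mul]
    have hRz : PadicInt.toZMod (R z) = PadicInt.toZMod (R z₀) := by
      rw [← sub_eq_zero, ← map_sub, toZMod_eq_zero_iff]
      change ‖((R z : ℤ_[3]) : ℚ_[3]) - R z₀‖ < 1
      rw [hR, hR, hwz, hwz₀]
      exact hz2
    change ((μ z₀ : ℂˣ) : ℂ) = ((μ z : ℂˣ) : ℂ)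
    rw [hμ, hμ, hz1, hκ, hκ, hRz]
  · -- the Step-2 clause on `ℚ₃^×`
    have ha0 : (a : ℚ_[3]) ≠ 0 := a.ne_zero
    set za : (QuadraticAlgebra ℚ_[3] 3 0)ˣ := Units.map (algebraMap ℚ_[3] (QuadraticAlgebra ℚ_[3] 3 0)).toMonoidHom a
      with hza
    have hza' : ((za : (QuadraticAlgebra ℚ_[3] 3 0)ˣ) : QuadraticAlgebra ℚ_[3] 3 0) =
        algebraMap ℚ_[3] (QuadraticAlgebra ℚ_[3] 3 0) a := rfl
    set v : ℤ := (a : ℚ_[3]).valuation with hv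
    have hNza : ((Nu za : ℚ_[3]ˣ) : ℚ_[3]) = (a : ℚ_[3]) ^ 2 := by
      rw [hNu, hza', QuadraticAlgebra.norm_algebraMap]
    have hkza : kf za = 2 * v := by rw [hkf, hNza, Padic.valuation_pow, hv]; norm_cast
    -- `(√3)^2 = 3`, so `(√3)^{2v} = 3^v` and the unit part of `a` is `u = a · 3^{−v}`
    set u : ℚ_[3] := (a : ℚ_[3]) * 3 ^ (-v) with hu
    have hu0 : u ≠ 0 := mul_ne_zero ha0 (zpow_ne_zero _ h3ne)
    have hωsq : ((ωu ^ (2 : ℤ) : (QuadraticAlgebra ℚ_[3] 3 0)ˣ) : QuadraticAlgebra ℚ_[3] 3 0) =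
        algebraMap ℚ_[3] (QuadraticAlgebra ℚ_[3] 3 0) 3 := by
      rw [Units.val_zpow_eq_zpow_val, hωu, zpow_two, QuadraticAlgebra.algebraMap_eq]
      ext <;> simp
    have hwza : ((wu za : (QuadraticAlgebra ℚ_[3] 3 0)ˣ) : QuadraticAlgebra ℚ_[3] 3 0) =
        algebraMap ℚ_[3] (QuadraticAlgebra ℚ_[3] 3 0) u := by
      rw [hwu, hkza, zpow_mul, Units.val_mul, hza', Units.val_inv_eq_inv_val, Units.val_zpow_eq_zpow_val, hωsq,
        ← map_zpow₀, ← map_inv₀, ← map_mul, hu, zpow_neg]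
    have hRa : ((R za : ℤ_[3]) : ℚ_[3]) = u := by rw [hR, hwza, QuadraticAlgebra.algebraMap_eq]
    have hnu : ‖u‖ = 1 := by rw [← hRa]; exact (hco za).2.2
    set U : ℤ_[3] := ⟨u, hnu.le⟩ with hUdef
    have hU : ((U : ℤ_[3]) : ℚ_[3]) = u := rfl
    have hRza : R za = U := PadicInt.ext hRa
    have hμa : μ za = (-1) ^ v * (-1) ^ (κ za).val := by rw [hμ, hkza, zpow_mul, huI2]
    -- the right-hand side: `a` is a norm
    have hRHS : (∃ x : (QuadraticAlgebra ℚ_[3] 3 0)ˣ, (x : QuadraticAlgebra ℚ_[3] 3 0) * S.conj x =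
        algebraMap ℚ_[3] (QuadraticAlgebra ℚ_[3] 3 0) a) ↔
        ∃ x : (QuadraticAlgebra ℚ_[3] 3 0)ˣ, (x : QuadraticAlgebra ℚ_[3] 3 0).norm = a := by
      simp only [hS, ← QuadraticAlgebra.algebraMap_norm_eq_mul_star, QuadraticAlgebra.algebraMap_inj]
    rw [hRHS]
    constructor
    · -- `μ(a) = 1 ⇒ a ∈ Nm E^×`
      intro h1
      rw [hμa, hκ, hRza] at h1
      rcases Int.even_or_odd v with hev | hodd
      · -- `v` even: `u ≡ 1 (mod 3)` is a square `c²`, and `a = Nm(3^{v/2} c)`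
        rw [hev.neg_one_zpow, one_mul] at h1
        have hU1 : PadicInt.toZMod U = 1 := by
          have hne2 : PadicInt.toZMod U ≠ 2 := fun h2 => by
            rw [if_pos h2, (by decide : (1 : ZMod 2).val = 1), pow_one] at h1
            exact absurd (congrArg (fun w : ℂˣ => (w : ℂ)) h1) (by norm_num)
          have hcases : ∀ t : ZMod 3, t ≠ 0 → t ≠ 2 → t = 1 := by decide
          exact hcases _ (hRza ▸ hRne za) hne2
        obtain ⟨c, hc⟩ :=
          Literature.NumberTheory.QuadraticForms.padicInt_isSquare_of_toZMod_eq_one (p := 3) (by norm_num) hU1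
        obtain ⟨j, hj⟩ := hev
        have hcu : ((c : ℤ_[3]) : ℚ_[3]) * c = u := by rw [← hU, hc, PadicInt.coe_mul]
        have hx0 : algebraMap ℚ_[3] (QuadraticAlgebra ℚ_[3] 3 0) ((3 : ℚ_[3]) ^ j * c) ≠ 0 := by
          rw [Ne, map_eq_zero_iff _ QuadraticAlgebra.algebraMap_injective, mul_eq_zero, not_or]
          refine ⟨zpow_ne_zero _ h3ne, fun hc0 => hu0 ?_⟩
          rw [← hcu, hc0, mul_zero]
        refine ⟨Units.mk0 _ hx0, ?_⟩
        rw [Units.val_mk0, QuadraticAlgebra.norm_algebraMap]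
        calc ((3 : ℚ_[3]) ^ j * c) ^ 2 = (3 : ℚ_[3]) ^ (j + j) * (((c : ℤ_[3]) : ℚ_[3]) * c) := by
              rw [zpow_add₀ h3ne]; ring
          _ = (a : ℚ_[3]) := by
              rw [hcu, ← hj, hu, mul_comm, mul_assoc, ← zpow_add₀ h3ne, neg_add_cancel, zpow_zero, mul_one]
      · -- `v` odd: `u ≡ 2 (mod 3)`, `−u = c²`, and `a = Nm(√3 · 3^{(v−1)/2} c)`
        rw [hodd.neg_one_zpow] at h1
        have hU2 : PadicInt.toZMod U = 2 := by
          by_contra hne2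
          rw [if_neg hne2, ZMod.val_zero, pow_zero, mul_one] at h1
          exact absurd (congrArg (fun w : ℂˣ => (w : ℂ)) h1) (by norm_num)
        have hneg : PadicInt.toZMod (-U) = 1 := by rw [map_neg, hU2]; decide
        obtain ⟨c, hc⟩ :=
          Literature.NumberTheory.QuadraticForms.padicInt_isSquare_of_toZMod_eq_one (p := 3) (by norm_num) hneg
        obtain ⟨j, hj⟩ := hodd
        have hcu : ((c : ℤ_[3]) : ℚ_[3]) * c = -u := by rw [← hU, ← PadicInt.coe_neg, hc, PadicInt.coe_mul]
        have hx0 : (⟨0, 1⟩ : QuadraticAlgebra ℚ_[3] 3 0) *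
            algebraMap ℚ_[3] (QuadraticAlgebra ℚ_[3] 3 0) ((3 : ℚ_[3]) ^ j * c) ≠ 0 := by
          rw [Ne, mul_eq_zero, not_or, map_eq_zero_iff _ QuadraticAlgebra.algebraMap_injective, mul_eq_zero, not_or]
          refine ⟨hω0, zpow_ne_zero _ h3ne, fun hc0 => hu0 ?_⟩
          have : -u = 0 := by rw [← hcu, hc0, mul_zero]
          exact neg_eq_zero.1 this
        refine ⟨Units.mk0 _ hx0, ?_⟩
        rw [Units.val_mk0, map_mul, norm_sqrt_three, QuadraticAlgebra.norm_algebraMap]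
        calc -3 * ((3 : ℚ_[3]) ^ j * c) ^ 2 = -(3 : ℚ_[3]) ^ (2 * j + 1) * (((c : ℤ_[3]) : ℚ_[3]) * c) := by
              rw [zpow_add₀ h3ne, zpow_one, two_mul, zpow_add₀ h3ne]; ring
          _ = (a : ℚ_[3]) := by
              rw [hcu, ← hj, hu]
              rw [show -(3 : ℚ_[3]) ^ v * -((a : ℚ_[3]) * 3 ^ (-v)) = (a : ℚ_[3]) * (3 ^ v * 3 ^ (-v)) by ring,
                ← zpow_add₀ h3ne, add_neg_cancel, zpow_zero, mul_one]
    · -- `a = Nm(x) ⇒ μ(a) = 1`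
      rintro ⟨x, hx⟩
      have hkx : kf x = v := by rw [hkf, hNu, hx, hv]
      -- `Nm(w(x)) = u · (−1)^v`, and `Nm(w(x)) ≡ re(w(x))² ≡ 1 (mod 3)`
      have hNw : ((wu x : (QuadraticAlgebra ℚ_[3] 3 0)ˣ) : QuadraticAlgebra ℚ_[3] 3 0).norm = u * (-1) ^ v := by
        have h1 : ((Nu (wu x) : ℚ_[3]ˣ) : ℚ_[3]) =
            ((Nu x : ℚ_[3]ˣ) : ℚ_[3]) * ((((Nu ωu) ^ kf x)⁻¹ : ℚ_[3]ˣ) : ℚ_[3]) := by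
          rw [hwu, map_mul, map_inv, map_zpow, Units.val_mul]
        rw [hNu, hNu, Units.val_inv_eq_inv_val, Units.val_zpow_eq_zpow_val, hNuω, hx, hkx] at h1
        rw [h1, hu, show (-3 : ℚ_[3]) = (-1) * 3 by ring, mul_zpow, mul_inv, ← inv_zpow, inv_neg_one, ← zpow_neg]
        ring
      rw [hμa, hκ, hRza]
      rcases Int.even_or_odd v with hev | hodd
      · rw [hev.neg_one_zpow, one_mul]
        have hN' : R x * R x - 3 * (Im x * Im x) = U := PadicInt.ext (by
          push_cast [hR, hIm, c3, hU]
          have h := hNw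
          rw [norm_eq, hev.neg_one_zpow, mul_one] at h
          linear_combination h)
        have hred := congrArg PadicInt.toZMod hN'
        rw [map_sub, map_mul, map_mul, map_ofNat, h30, zero_mul, sub_zero, zmod3_mul_self_eq_one _ (hRne x)] at hred
        rw [← hred, if_neg (by decide), ZMod.val_zero, pow_zero]
      · rw [hodd.neg_one_zpow]
        have hN' : R x * R x - 3 * (Im x * Im x) = -U := PadicInt.ext (by
          push_cast [hR, hIm, c3, hU]
          have h := hNw
          rw [norm_eq, hodd.neg_one_zpow, mul_neg, mul_one] at h
          linear_combination h)
        have hred := congrArg PadicInt.toZMod hN'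
        rw [map_sub, map_mul, map_mul, map_ofNat, h30, zero_mul, sub_zero, zmod3_mul_self_eq_one _ (hRne x),
          map_neg] at hred
        have hU2 : PadicInt.toZMod U = 2 := by
          have hcases : ∀ t : ZMod 3, 1 = -t → t = 2 := by decide
          exact hcases _ hred
        rw [hU2, if_pos rfl, (by decide : (1 : ZMod 2).val = 1), pow_one, neg_mul_neg, one_mul]

/-- **A Step-2 character EXISTS at the ramified datum, and `μ(√3)² = −1` for it** (as for every Step-2 character there,
`muSet_apply_three`): the printed index set `MuSet S` of [Liu2021, §D.1 Step 2] is inhabited over `ℚ₃(√3)/ℚ₃` — by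
`μ = I^{ord_E} · (unit part | 3)`, see the construction `nonempty_muSet_ramified` — and its members have order divisible by `4`.
[cite: Liu2021, App. D §D.1 Step 2 (l. 5219)] -/
theorem exists_muSet_sq_sqrt_three (hS : ∀ x, S.conj x = star x) :
    ∃ μ : LemD1.MuSet S, ∀ e : (QuadraticAlgebra ℚ_[3] 3 0)ˣ, (e : QuadraticAlgebra ℚ_[3] 3 0) = ⟨0, 1⟩ → μ.1 e * μ.1 e = -1 := by
  haveI hF : Fact (∀ r : ℚ_[3], r ^ 2 ≠ 3 + 0 * r) := ⟨sq_ne_three⟩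
  obtain ⟨μ⟩ := nonempty_muSet_ramified hS
  refine ⟨μ, fun e he => ?_⟩
  have h3 : e * e = Units.map (algebraMap ℚ_[3] (QuadraticAlgebra ℚ_[3] 3 0)).toMonoidHom (Units.mk0 (3 : ℚ_[3]) (by norm_num)) :=
    Units.ext (by
      rw [Units.val_mul, he]
      change _ = algebraMap ℚ_[3] (QuadraticAlgebra ℚ_[3] 3 0) 3
      rw [QuadraticAlgebra.algebraMap_eq]
      ext <;> simp)
  rw [← map_mul, h3]
  exact muSet_apply_three hS μ

end StepTwo

/-! ## §5 The CUBIC character of `E¹` at the ramified place (`E¹ → 𝔽₃`, `a + b√3 ↦ ā·b̄`; `ψ = ζ₃^{ā b̄}`), trivial near `1`,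
`ψ(2 + √3) = ζ₃²` — a non-trivial line `ψ ∘ det` of `U(V)(ℚ₃)` with TRIVIAL central character at rank `3` -/

section CubicCharacter

/-- In `𝔽₃`: for `x² = 1 = u²`, `(x u)·(x v + y u) = x y + u v` — additivity of `(a, b) ↦ ā b̄` on the norm-one elements
`a + b√3` (`a² − 3b² = 1`, so `ā² = 1`) under `(a, b)·(a', b') = (a a' + 3 b b', a b' + b a')`. [folklore] -/
private theorem zmod3_cubic : ∀ x y u v : ZMod 3, x * x = 1 → u * u = 1 → (x * u) * (x * v + y * u) = x * y + u * v := by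
  decide

/-- A primitive cube root of unity `ζ₃ = e^{2πi/3}` as a unit of `ℂ`: `ζ₃³ = 1`, `ζ₃ ≠ 1`, `ζ₃² ≠ 1`, `‖ζ₃‖ = 1`. [folklore] -/
private theorem exists_cubeRoot_unit : ∃ ζ : ℂˣ, ζ ^ 3 = 1 ∧ ζ ≠ 1 ∧ ζ ^ 2 ≠ 1 ∧ ‖(ζ : ℂ)‖ = 1 := by
  have hprim : IsPrimitiveRoot (Complex.exp (2 * Real.pi * Complex.I / (3 : ℕ))) 3 :=
    Complex.isPrimitiveRoot_exp 3 (by norm_num)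
  have hu : IsUnit (Complex.exp (2 * Real.pi * Complex.I / (3 : ℕ))) := hprim.isUnit (by norm_num)
  have hζ : IsPrimitiveRoot hu.unit 3 := IsPrimitiveRoot.coe_units_iff.1 (by rw [hu.unit_spec]; exact hprim)
  exact ⟨hu.unit, hζ.pow_eq_one, hζ.ne_one (by norm_num), hζ.pow_ne_one_of_pos_of_lt two_ne_zero (by norm_num),
    by rw [hu.unit_spec]; exact hprim.norm'_eq_one (by norm_num)⟩

variable {n : ℕ} {S : OscillatorStandingData ℚ_[3] (QuadraticAlgebra ℚ_[3] 3 0) n}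
  [TopologicalSpace (QuadraticAlgebra ℚ_[3] 3 0)] [IsModuleTopology ℚ_[3] (QuadraticAlgebra ℚ_[3] 3 0)]

/-- **The cubic character of `E¹` at the ramified place**: for `z = a + b√3 ∈ E¹` (`a² − 3b² = 1`, so `a ∈ ℤ₃^×`, `b ∈ ℤ₃`,
`ā = ±1`) put `φ(z) := ā·b̄ ∈ 𝔽₃` — the level-one digit of `z/(±1)` —, which is ADDITIVE (`E¹/E¹ ∩ (±1 + 3𝒪_E)`-valued), and
`ψ(z) := ζ₃^{φ(z)}`.  It is a unitary, continuous (locally constant: `ψ = 1` on `{‖a − 1‖ < 1, ‖b‖ < 1}`) character of `E¹` with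
`ψ³ = 1`, and NON-trivial: `ψ(2 + √3) = ζ₃²`, so `ψ(2 + √3) ≠ 1` and `ψ(2 + √3)² ≠ 1`.  At rank `3` the line `ψ ∘ det` has TRIVIAL
central character (`ψ(z³) = ψ(z)³ = 1`). [cite: Liu2021, App. D §D.1 Step 3 (l. 5221)] -/
theorem exists_cubicChar (hS : ∀ x, S.conj x = star x) :
    ∃ ψ : S.normOne →* ℂˣ, (∀ z, ‖((ψ z : ℂˣ) : ℂ)‖ = 1) ∧ (Continuous fun z : S.normOne => ((ψ z : ℂˣ) : ℂ)) ∧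
      (∀ z, ψ z ^ 3 = 1) ∧
      (∀ z : S.normOne, ‖(((z : (QuadraticAlgebra ℚ_[3] 3 0)ˣ)) : QuadraticAlgebra ℚ_[3] 3 0).re - 1‖ < 1 →
        ‖(((z : (QuadraticAlgebra ℚ_[3] 3 0)ˣ)) : QuadraticAlgebra ℚ_[3] 3 0).im‖ < 1 → ψ z = 1) ∧
      ∃ z₁ : S.normOne, (((z₁ : (QuadraticAlgebra ℚ_[3] 3 0)ˣ)) : QuadraticAlgebra ℚ_[3] 3 0) = ⟨2, 1⟩ ∧
        ψ z₁ ≠ 1 ∧ ψ z₁ ^ 2 ≠ 1 := by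
  classical
  haveI hF : Fact (∀ r : ℚ_[3], r ^ 2 ≠ 3 + 0 * r) := ⟨sq_ne_three⟩
  have hN1 : ∀ z : S.normOne, (((z : (QuadraticAlgebra ℚ_[3] 3 0)ˣ)) : QuadraticAlgebra ℚ_[3] 3 0).re ^ 2 -
      3 * (((z : (QuadraticAlgebra ℚ_[3] 3 0)ˣ)) : QuadraticAlgebra ℚ_[3] 3 0).im ^ 2 = 1 := fun z => by
    have h := (S.mem_normOne_iff' _).1 z.2
    rw [hS, ← QuadraticAlgebra.algebraMap_norm_eq_mul_star, ← QuadraticAlgebra.C_eq_algebraMap,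
      QuadraticAlgebra.C_eq_one_iff, norm_eq] at h
    exact h
  have hco := fun z : S.normOne => coords_of_norm_norm_eq_one
    (a := (((z : (QuadraticAlgebra ℚ_[3] 3 0)ˣ)) : QuadraticAlgebra ℚ_[3] 3 0).re)
    (b := (((z : (QuadraticAlgebra ℚ_[3] 3 0)ˣ)) : QuadraticAlgebra ℚ_[3] 3 0).im) (by rw [hN1 z, norm_one])
  let A : S.normOne → ℤ_[3] := fun z => ⟨_, (hco z).1⟩
  let B : S.normOne → ℤ_[3] := fun z => ⟨_, (hco z).2.1⟩
  have hA : ∀ z, ((A z : ℤ_[3]) : ℚ_[3]) = (((z : (QuadraticAlgebra ℚ_[3] 3 0)ˣ)) : QuadraticAlgebra ℚ_[3] 3 0).re :=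
    fun z => rfl
  have hB : ∀ z, ((B z : ℤ_[3]) : ℚ_[3]) = (((z : (QuadraticAlgebra ℚ_[3] 3 0)ˣ)) : QuadraticAlgebra ℚ_[3] 3 0).im :=
    fun z => rfl
  have c3 : ((3 : ℤ_[3]) : ℚ_[3]) = 3 := rfl
  have h30 : (3 : ZMod 3) = 0 := by decide
  have hAA : ∀ z, PadicInt.toZMod (A z) * PadicInt.toZMod (A z) = 1 := fun z => by
    have h : A z * A z - 3 * (B z * B z) = 1 := PadicInt.ext (by
      push_cast [hA, hB, c3]; rw [← sq, ← sq]; exact hN1 z)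
    have := congrArg PadicInt.toZMod h
    rwa [map_sub, map_mul, map_mul, map_ofNat, h30, zero_mul, sub_zero, map_one] at this
  have hAmul : ∀ z w, A (z * w) = A z * A w + 3 * (B z * B w) := fun z w => PadicInt.ext (by
    push_cast [hA, hB, c3]
    change ((((z : (QuadraticAlgebra ℚ_[3] 3 0)ˣ) : QuadraticAlgebra ℚ_[3] 3 0) *
      ((w : (QuadraticAlgebra ℚ_[3] 3 0)ˣ) : QuadraticAlgebra ℚ_[3] 3 0))).re = _
    rw [QuadraticAlgebra.re_mul]
    ring)
  have hBmul : ∀ z w, B (z * w) = A z * B w + B z * A w := fun z w => PadicInt.ext (by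
    push_cast [hA, hB]
    change ((((z : (QuadraticAlgebra ℚ_[3] 3 0)ˣ) : QuadraticAlgebra ℚ_[3] 3 0) *
      ((w : (QuadraticAlgebra ℚ_[3] 3 0)ˣ) : QuadraticAlgebra ℚ_[3] 3 0))).im = _
    rw [QuadraticAlgebra.im_mul]
    ring)
  -- the exponent `φ = ā b̄`
  let φ : S.normOne → ZMod 3 := fun z => PadicInt.toZMod (A z) * PadicInt.toZMod (B z)
  have hφ : ∀ z, φ z = PadicInt.toZMod (A z) * PadicInt.toZMod (B z) := fun z => rfl
  have hφmul : ∀ z w, φ (z * w) = φ z + φ w := fun z w => by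
    rw [hφ, hφ, hφ, hAmul, hBmul, map_add, map_mul, map_mul, map_ofNat, h30, zero_mul, add_zero, map_add, map_mul,
      map_mul]
    exact zmod3_cubic _ _ _ _ (hAA z) (hAA w)
  obtain ⟨ζ, hζ3, hζ1, hζ2, hζn⟩ := exists_cubeRoot_unit
  have hpow : ∀ a b : ZMod 3, ζ ^ (a + b).val = ζ ^ a.val * ζ ^ b.val := fun a b => by
    rw [← pow_add, ZMod.val_add]
    conv_rhs => rw [← Nat.div_add_mod (a.val + b.val) 3, pow_add, pow_mul, hζ3, one_pow, one_mul]
  have hA1 : A 1 = 1 := PadicInt.ext (by rw [hA]; simp [QuadraticAlgebra.re_one])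
  have hB1 : B 1 = 0 := PadicInt.ext (by rw [hB]; simp [QuadraticAlgebra.im_one])
  let ψ : S.normOne →* ℂˣ :=
    { toFun := fun z => ζ ^ (φ z).val
      map_one' := by rw [hφ, hA1, hB1, map_zero, mul_zero, ZMod.val_zero, pow_zero]
      map_mul' := fun z w => by simp only [hφmul, hpow] }
  have hψ : ∀ z, ψ z = ζ ^ (φ z).val := fun z => rfl
  have hre_cont : Continuous fun z : S.normOne =>
      (((z : (QuadraticAlgebra ℚ_[3] 3 0)ˣ)) : QuadraticAlgebra ℚ_[3] 3 0).re :=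
    continuous_re.comp (Units.continuous_val.comp continuous_subtype_val)
  have him_cont : Continuous fun z : S.normOne =>
      (((z : (QuadraticAlgebra ℚ_[3] 3 0)ˣ)) : QuadraticAlgebra ℚ_[3] 3 0).im :=
    continuous_im.comp (Units.continuous_val.comp continuous_subtype_val)
  have hloc : ∀ (a b : ℤ_[3]), ‖(a : ℚ_[3]) - b‖ < 1 → PadicInt.toZMod a = PadicInt.toZMod b := fun a b h => by
    rw [← sub_eq_zero, ← map_sub, toZMod_eq_zero_iff]
    exact h
  -- the witness `z₁ = 2 + √3`
  have hz₁ne : (⟨2, 1⟩ : QuadraticAlgebra ℚ_[3] 3 0) ≠ 0 := fun h => by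
    have := congrArg QuadraticAlgebra.im h
    norm_num at this
  have hz₁1 : Units.mk0 (⟨2, 1⟩ : QuadraticAlgebra ℚ_[3] 3 0) hz₁ne ∈ S.normOne := by
    rw [S.mem_normOne_iff', Units.val_mk0, hS, QuadraticAlgebra.star_mk]
    ext
    · simp [QuadraticAlgebra.re_one]; norm_num
    · simp [QuadraticAlgebra.im_one]
  let z₁ : S.normOne := ⟨_, hz₁1⟩
  have hAz₁ : A z₁ = 2 := PadicInt.ext (by rw [hA]; rfl)
  have hBz₁ : B z₁ = 1 := PadicInt.ext (by rw [hB]; rfl)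
  have hφz₁ : φ z₁ = 2 := by rw [hφ, hAz₁, hBz₁, map_ofNat, map_one, mul_one]
  have hψz₁ : ψ z₁ = ζ ^ 2 := by rw [hψ, hφz₁]; rfl
  refine ⟨ψ, fun z => ?_, ?_, fun z => ?_, fun z hre him => ?_, z₁, rfl, ?_, ?_⟩
  · rw [hψ, Units.val_pow_eq_pow_val, norm_pow, hζn, one_pow]
  · refine IsLocallyConstant.continuous ((IsLocallyConstant.iff_exists_open _).2 fun z => ?_)
    refine ⟨{w | ‖(((w : (QuadraticAlgebra ℚ_[3] 3 0)ˣ)) : QuadraticAlgebra ℚ_[3] 3 0).re -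
        (((z : (QuadraticAlgebra ℚ_[3] 3 0)ˣ)) : QuadraticAlgebra ℚ_[3] 3 0).re‖ < 1 ∧
        ‖(((w : (QuadraticAlgebra ℚ_[3] 3 0)ˣ)) : QuadraticAlgebra ℚ_[3] 3 0).im -
        (((z : (QuadraticAlgebra ℚ_[3] 3 0)ˣ)) : QuadraticAlgebra ℚ_[3] 3 0).im‖ < 1},
      (isOpen_lt (continuous_norm.comp (hre_cont.sub continuous_const)) continuous_const).inter
        (isOpen_lt (continuous_norm.comp (him_cont.sub continuous_const)) continuous_const), ?_, fun w hw => ?_⟩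
    · change ‖_‖ < 1 ∧ ‖_‖ < 1
      rw [sub_self, sub_self, norm_zero]
      exact ⟨one_pos, one_pos⟩
    · obtain ⟨hw1, hw2⟩ := hw
      rw [hψ, hψ, hφ, hφ, hloc (A w) (A z) hw1, hloc (B w) (B z) hw2]
  · rw [hψ, ← pow_mul, mul_comm, pow_mul, hζ3, one_pow]
  · have h1 : PadicInt.toZMod (A z) = PadicInt.toZMod (A 1) := hloc _ _ (by rw [hA, hA1, PadicInt.coe_one]; exact hre)
    have h2 : PadicInt.toZMod (B z) = PadicInt.toZMod (B 1) :=
      hloc _ _ (by rw [hB, hB1, PadicInt.coe_zero, sub_zero]; exact him)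
    rw [hψ, hφ, h1, h2, hA1, hB1, map_zero, mul_zero, ZMod.val_zero, pow_zero]
  · rw [hψz₁]; exact hζ2
  · rw [hψz₁, ← pow_mul, show 2 * 2 = 3 + 1 from rfl, pow_add, hζ3, one_mul, pow_one]
    exact hζ1

end CubicCharacter

/-! ## §6 The certificate at the ramified place, rank `n = 3`: two members differing ONLY by the flip `ε ↦ −ε` of the
Step-1 representative — different classes, non-isomorphic quotients, «(1) ∧ (3)» holds -/

section Certificate

variable {G Z : Type*} [Group G] [Group Z]

/-- If `G` acts on the line `ℂ` through a character `λ` agreeing with `χ` on the central subgroup `ζ(Z)`, the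
`χ`-augmentation submodule vanishes (the maximal `χ`-quotient is the line itself). [folklore] -/
private theorem augmentation_eq_bot_of_character (ρ : Representation ℂ G ℂ) (ζ : Z →* G) (χ : Z →* ℂˣ) (lam : G →* ℂˣ)
    (h : ∀ (g : G) (x : ℂ), ρ g x = (lam g : ℂ) * x) (hcen : ∀ z, lam (ζ z) = χ z) : augmentation ρ ζ χ = ⊥ := by
  unfold augmentation
  refine iSup_eq_bot.2 fun z => ?_
  rw [LinearMap.range_eq_bot]
  ext
  simp [h, hcen]

/-- Two character lines have isomorphic maximal `χ`-quotients iff the characters coincide (both quotients being the lines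
themselves). [folklore] -/
private theorem areIsomorphicRep_quotRep_iff_of_character (ρ₁ ρ₂ : Representation ℂ G ℂ) {ζ : Z →* G}
    (hζ : ∀ z, ζ z ∈ Subgroup.center G) (χ₁ χ₂ : Z →* ℂˣ) (lam₁ lam₂ : G →* ℂˣ)
    (h₁ : ∀ (g : G) (x : ℂ), ρ₁ g x = (lam₁ g : ℂ) * x) (h₂ : ∀ (g : G) (x : ℂ), ρ₂ g x = (lam₂ g : ℂ) * x)
    (hN₁ : augmentation ρ₁ ζ χ₁ = ⊥) (hN₂ : augmentation ρ₂ ζ χ₂ = ⊥) :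
    AreIsomorphicRep (quotRep ρ₁ hζ χ₁) (quotRep ρ₂ hζ χ₂) ↔ lam₁ = lam₂ := by
  have hact₁ : ∀ (g : G) (u : ℂ), quotRep ρ₁ hζ χ₁ g (Submodule.Quotient.mk u) =
      (lam₁ g : ℂ) • (Submodule.Quotient.mk u : ℂ ⧸ augmentation ρ₁ ζ χ₁) := fun g u => by
    rw [quotRep_mk, h₁, ← smul_eq_mul, Submodule.Quotient.mk_smul]
  have hact₂ : ∀ (g : G) (u : ℂ), quotRep ρ₂ hζ χ₂ g (Submodule.Quotient.mk u) =
      (lam₂ g : ℂ) • (Submodule.Quotient.mk u : ℂ ⧸ augmentation ρ₂ ζ χ₂) := fun g u => by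
    rw [quotRep_mk, h₂, ← smul_eq_mul, Submodule.Quotient.mk_smul]
  constructor
  · rintro ⟨f, hf⟩
    ext g
    have hw : (Submodule.Quotient.mk 1 : ℂ ⧸ augmentation ρ₁ ζ χ₁) ≠ 0 := by
      rw [Ne, Submodule.Quotient.mk_eq_zero, hN₁, Submodule.mem_bot]
      exact one_ne_zero
    have key := hf g (Submodule.Quotient.mk 1)
    obtain ⟨u, hu⟩ := Submodule.Quotient.mk_surjective _ (f (Submodule.Quotient.mk 1))
    rw [hact₁, map_smul, ← hu, hact₂] at key
    have hsub : ((lam₁ g : ℂ) - lam₂ g) • (Submodule.Quotient.mk u : ℂ ⧸ augmentation ρ₂ ζ χ₂) = 0 := by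
      rw [sub_smul, key, sub_self]
    rcases smul_eq_zero.1 hsub with h | h
    · exact sub_eq_zero.1 h
    · exact (hw (f.injective (by rw [← hu, h, map_zero]))).elim
  · rintro rfl
    refine ⟨(Submodule.quotEquivOfEqBot _ hN₁).trans (Submodule.quotEquivOfEqBot _ hN₂).symm, fun g w => ?_⟩
    obtain ⟨u, rfl⟩ := Submodule.Quotient.mk_surjective _ w
    rw [hact₁, map_smul, LinearEquiv.trans_apply, Submodule.quotEquivOfEqBot_apply_mk,
      Submodule.quotEquivOfEqBot_symm_apply, hact₂]

variable {n : ℕ} {S : OscillatorStandingData ℚ_[3] (QuadraticAlgebra ℚ_[3] 3 0) n}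

/-- **`det : U(V)(F) → E¹`** for Gram matrix `1` at the ramified place (`det(ḡᵀ g) = N(det g) = 1`).
[cite: Liu2021, App. D §D.1 (l. 5213)] -/
theorem exists_detNormOne (hgram : S.gram = 1) :
    ∃ d : S.U →* S.normOne, ∀ g : S.U, ((d g : S.normOne) : (QuadraticAlgebra ℚ_[3] 3 0)ˣ) =
      Matrix.GeneralLinearGroup.det (g : GL (Fin n) (QuadraticAlgebra ℚ_[3] 3 0)) := by
  have hmem : ∀ g : S.U,
      Matrix.GeneralLinearGroup.det (g : GL (Fin n) (QuadraticAlgebra ℚ_[3] 3 0)) ∈ S.normOne := by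
    intro g
    rw [S.mem_normOne_iff', Matrix.GeneralLinearGroup.val_det_apply]
    have h := (S.mem_U_iff _).1 g.2
    rw [hgram, Matrix.mul_one] at h
    have hd := congrArg Matrix.det h
    rw [Matrix.det_mul, Matrix.det_transpose, Matrix.det_one, ← AlgEquiv.mapMatrix_apply, ← AlgEquiv.map_det,
      mul_comm] at hd
    exact hd
  exact ⟨MonoidHom.codRestrict ((Matrix.GeneralLinearGroup.det).comp S.U.subtype) S.normOne hmem, fun g => rfl⟩

variable [TopologicalSpace (QuadraticAlgebra ℚ_[3] 3 0)] [IsTopologicalRing (QuadraticAlgebra ℚ_[3] 3 0)]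
  [IsModuleTopology ℚ_[3] (QuadraticAlgebra ℚ_[3] 3 0)]

/-- **NON-VACUITY OF «LEMMA D.1 (1) ∧ (3)» AT THE RAMIFIED PLACE, WITH THE FLIP `ε ↦ −ε` ALONE DECIDING (3)** (in-kernel
certificate, our bookkeeping; no statement about Liu's `ω(μ, ε)`).  Over `F = ℚ₃`, `E = ℚ₃(√3)` — a FIELD —, `c : √3 ↦ −√3`, the
hermitian space `(E³, 1)` of the rows' rank `n = 3`, `E` with its module topology (any instance of it), there is a two-member
collection `Lf : LemD1IndexedFamily ℚ_[3] E 3 (Fin 2)` with ONE Step-2 character `μ` (§4) and ONE Step-3 character `χ = 1` for both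
members, Step-1 representatives `ε₀ = √3` and `ε₁ = −√3 = −ε₀` — EXACTLY the flipped representative of [Liu2021, Lemma D.1 (2)]
(tree `LemD1.epsNeg`) —, and ⟨CARRIER⟩ lines `ω(μ, ε₀) = 1`, `ω(μ, ε₁) = ψ ∘ det` (`ψ` the cubic character of `E¹`, §5; central
character `ψ(z³) = 1`), such that `Lf.Item1AsPrinted` (lines, non-zero: (1)'s right side fails through «`n = 2`») ∧
`LemD1_3AsPrintedI Lf` (all four pairs) ∧ the two members carry the SAME `μ` and `χ`, representatives `ε₁ = −ε₀` in DIFFERENT classes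
of `E^{−×}/Nm E^×` (`not_sameClass_epsNeg`), and NON-isomorphic `ω(μ, ε, χ)` (`ψ(det diag(2 + √3, 1, 1)) = ζ₃² ≠ 1`).  So at a
ramified place the tree's reading of «`ε' = ε`» (READING L3′, classes) separates `ε` from `−ε`, and the printed criterion (3)
then REQUIRES `ω(μ, −ε, χ) ≇ ω(μ, ε, χ)` — the hypothesis set «(1) ∧ (3) ∧ `E` a field ∧ two members related by the flip of
item (2)» is consistent. [cite: Liu2021, App. D Lemma D.1 (1) (l. 5229), (2) (l. 5231), (3) (l. 5233); §D.1 Steps 1–3 (l. 5217–5221)] -/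
theorem exists_lemD1IndexedFamily_ramified_flip :
    ∃ Lf : LemD1IndexedFamily ℚ_[3] (QuadraticAlgebra ℚ_[3] 3 0) 3 (Fin 2),
      IsField (QuadraticAlgebra ℚ_[3] 3 0) ∧ (∀ x, Lf.S.conj x = star x) ∧ Lf.S.gram = 1 ∧
      Lf.Item1AsPrinted ∧ LemD1_3AsPrintedI Lf ∧
      Lf.mu 1 = Lf.mu 0 ∧ Lf.chi 1 = Lf.chi 0 ∧
      (((Lf.eps 0).1 : (QuadraticAlgebra ℚ_[3] 3 0)ˣ) : QuadraticAlgebra ℚ_[3] 3 0) = ⟨0, 1⟩ ∧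
      Lf.eps 1 = LemD1.epsNeg (Lf.eps 0) ∧ ¬ LemD1.SameClass (Lf.eps 0) (Lf.eps 1) ∧
      ¬ AreIsomorphicRep (Lf.quot 1) (Lf.quot 0) ∧ ¬ AreIsomorphicRep (Lf.quot 0) (Lf.quot 1) := by
  classical
  haveI hF : Fact (∀ r : ℚ_[3], r ^ 2 ≠ 3 + 0 * r) := ⟨sq_ne_three⟩
  obtain ⟨S, hS, hgram⟩ := exists_standingData 3 (by norm_num)
  obtain ⟨μ⟩ := nonempty_muSet_ramified (S := S) hS
  obtain ⟨ψ, -, -, hψ3, hψnear, z₁, hz₁, hψz₁, -⟩ := exists_cubicChar (S := S) hS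
  obtain ⟨detN, hdetN⟩ := exists_detNormOne (S := S) hgram
  -- Step 3: `χ = 1`
  let χ₁ : LemD1.ChiSet S := ⟨1, fun z => by simp, by simpa using continuous_const⟩
  -- Step 1: `ε₀ = √3`, `ε₁ = −√3`
  have hω0 : (⟨0, 1⟩ : QuadraticAlgebra ℚ_[3] 3 0) ≠ 0 := fun h => by
    have := congrArg QuadraticAlgebra.im h
    norm_num at this
  have hskew : (⟨0, 1⟩ : QuadraticAlgebra ℚ_[3] 3 0) ∈ S.skew := by
    rw [S.mem_skew_iff, hS, QuadraticAlgebra.star_mk]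
    ext <;> simp
  let e₀ : LemD1.EpsRep S := ⟨Units.mk0 _ hω0, by rw [Units.val_mk0]; exact hskew⟩
  have hflip : ¬ LemD1.SameClass e₀ (LemD1.epsNeg e₀) := not_sameClass_epsNeg hS e₀
  -- the line `ψ ∘ det`: central character `ψ(z³) = 1`
  let lam : S.U →* ℂˣ := ψ.comp detN
  have hlam : ∀ g, lam g = ψ (detN g) := fun g => rfl
  have hdet_scalar : ∀ z : S.normOne, detN (S.scalar z) = z ^ 3 := fun z => by
    apply Subtype.ext
    rw [hdetN]
    apply Units.ext
    rw [Matrix.GeneralLinearGroup.val_det_apply, SubgroupClass.coe_pow, Units.val_pow_eq_pow_val]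
    change (Matrix.scalar (Fin 3) (((z : (QuadraticAlgebra ℚ_[3] 3 0)ˣ)) : QuadraticAlgebra ℚ_[3] 3 0)).det = _
    simp [Matrix.scalar_apply, Matrix.det_diagonal, Finset.prod_const]
  have hcen : ∀ z : S.normOne, lam (S.scalar z) = χ₁.1 z := fun z => by
    change lam _ = (1 : S.normOne →* ℂˣ) z
    rw [hlam, hdet_scalar, map_pow, hψ3, MonoidHom.one_apply]
  have hcen1 : ∀ z : S.normOne, (1 : S.U →* ℂˣ) (S.scalar z) = χ₁.1 z := fun z => rfl
  -- the witness `g₁ = diag(2 + √3, 1, 1) ∈ U(V)(F)`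
  have hdet_val : ∀ g : S.U, (((detN g : S.normOne) : (QuadraticAlgebra ℚ_[3] 3 0)ˣ) : QuadraticAlgebra ℚ_[3] 3 0) =
      ((g : GL (Fin 3) (QuadraticAlgebra ℚ_[3] 3 0)) : Matrix (Fin 3) (Fin 3) (QuadraticAlgebra ℚ_[3] 3 0)).det :=
    fun g => by rw [hdetN, Matrix.GeneralLinearGroup.val_det_apply]
  obtain ⟨g₁, hg₁⟩ : ∃ g : S.U, detN g = z₁ := by
    let d : Fin 3 → QuadraticAlgebra ℚ_[3] 3 0 :=
      ![(((z₁ : (QuadraticAlgebra ℚ_[3] 3 0)ˣ)) : QuadraticAlgebra ℚ_[3] 3 0), 1, 1]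
    have hdet_d : (Matrix.diagonal d).det = (((z₁ : (QuadraticAlgebra ℚ_[3] 3 0)ˣ)) : QuadraticAlgebra ℚ_[3] 3 0) := by
      simp [Matrix.det_diagonal, Fin.prod_univ_three, d]
    have hddet : (Matrix.diagonal d).det ≠ 0 := by rw [hdet_d]; exact (z₁ : (QuadraticAlgebra ℚ_[3] 3 0)ˣ).ne_zero
    let A₀ : GL (Fin 3) (QuadraticAlgebra ℚ_[3] 3 0) := Matrix.GeneralLinearGroup.mkOfDetNeZero _ hddet
    have hA₀ : ((A₀ : GL (Fin 3) (QuadraticAlgebra ℚ_[3] 3 0)) : Matrix (Fin 3) (Fin 3) (QuadraticAlgebra ℚ_[3] 3 0)) =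
        Matrix.diagonal d := rfl
    have hu : star (((z₁ : (QuadraticAlgebra ℚ_[3] 3 0)ˣ)) : QuadraticAlgebra ℚ_[3] 3 0) *
        (((z₁ : (QuadraticAlgebra ℚ_[3] 3 0)ˣ)) : QuadraticAlgebra ℚ_[3] 3 0) = 1 := by
      rw [mul_comm, ← hS]; exact (S.mem_normOne_iff' _).1 z₁.2
    have hA₀U : A₀ ∈ S.U := by
      rw [S.mem_U_iff, hgram, Matrix.mul_one, hA₀, Matrix.diagonal_map (map_zero _), Matrix.diagonal_transpose,
        Matrix.diagonal_mul_diagonal, ← Matrix.diagonal_one]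
      congr 1
      funext k
      fin_cases k
      · simpa [d, hS] using hu
      · simp [d]
      · simp [d]
    refine ⟨⟨A₀, hA₀U⟩, Subtype.ext (Units.ext ?_)⟩
    rw [hdetN, Matrix.GeneralLinearGroup.val_det_apply]
    exact hdet_d
  have hg₁ne : lam g₁ ≠ 1 := by rw [hlam, hg₁]; exact hψz₁
  -- `λ = 1` near `1`
  have hre_det : Continuous fun g : S.U => (((g : GL (Fin 3) (QuadraticAlgebra ℚ_[3] 3 0)) :
      Matrix (Fin 3) (Fin 3) (QuadraticAlgebra ℚ_[3] 3 0)).det).re :=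
    continuous_re.comp ((Units.continuous_val.comp continuous_subtype_val).matrix_det)
  have him_det : Continuous fun g : S.U => (((g : GL (Fin 3) (QuadraticAlgebra ℚ_[3] 3 0)) :
      Matrix (Fin 3) (Fin 3) (QuadraticAlgebra ℚ_[3] 3 0)).det).im :=
    continuous_im.comp ((Units.continuous_val.comp continuous_subtype_val).matrix_det)
  have hopen : ∃ O : Set S.U, IsOpen O ∧ (1 : S.U) ∈ O ∧ ∀ g ∈ O, lam g = 1 := by
    refine ⟨{g : S.U | ‖(((g : GL (Fin 3) (QuadraticAlgebra ℚ_[3] 3 0)) :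
        Matrix (Fin 3) (Fin 3) (QuadraticAlgebra ℚ_[3] 3 0)).det).re - 1‖ < 1 ∧
        ‖(((g : GL (Fin 3) (QuadraticAlgebra ℚ_[3] 3 0)) :
        Matrix (Fin 3) (Fin 3) (QuadraticAlgebra ℚ_[3] 3 0)).det).im‖ < 1}, ?_, ?_, fun g hg => ?_⟩
    · exact (isOpen_lt (continuous_norm.comp (hre_det.sub continuous_const)) continuous_const).inter
        (isOpen_lt (continuous_norm.comp him_det) continuous_const)
    · change ‖_‖ < 1 ∧ ‖_‖ < 1
      simp [QuadraticAlgebra.re_one, QuadraticAlgebra.im_one]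
    · obtain ⟨hg1, hg2⟩ := hg
      rw [hlam]
      exact hψnear (detN g) (by rw [hdet_val]; exact hg1) (by rw [hdet_val]; exact hg2)
  -- the carriers
  let ω₀ : Representation ℂ S.U ℂ := (DistribMulAction.toModuleEnd ℂ ℂ).comp (1 : S.U →* ℂˣ)
  let ω₁ : Representation ℂ S.U ℂ := (DistribMulAction.toModuleEnd ℂ ℂ).comp lam
  have hω₀ : ∀ (g : S.U) (x : ℂ), ω₀ g x = ((1 : S.U →* ℂˣ) g : ℂ) * x := fun g x => by
    change ((1 : S.U →* ℂˣ) g : ℂˣ) • x = _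
    rw [Units.smul_def, smul_eq_mul]
  have hω₁ : ∀ (g : S.U) (x : ℂ), ω₁ g x = (lam g : ℂ) * x := fun g x => by
    change (lam g : ℂˣ) • x = _
    rw [Units.smul_def, smul_eq_mul]
  let Lf : LemD1IndexedFamily ℚ_[3] (QuadraticAlgebra ℚ_[3] 3 0) 3 (Fin 2) :=
    { isNonarchimedeanLocalField := Literature.NumberTheory.GaloisRepresentations.Padic.isNonarchimedeanLocalField_holds 3
      isModuleTopology := inferInstance
      S := S
      mu := fun _ => μ
      eps := ![e₀, LemD1.epsNeg e₀]
      chi := fun _ => χ₁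
      V := fun _ => ℂ
      omega := ![ω₀, ω₁] }
  have hItem1 : Lf.Item1AsPrinted := by
    intro i
    fin_cases i
    · exact LemD1IndexedNonVacuityNonsplit.lemD1_1AsPrinted_of_character_of_rank_ne_two (Lf.single 0) 1 hω₀ hcen1
        ⟨Set.univ, isOpen_univ, Set.mem_univ _, fun g _ => rfl⟩ (by norm_num)
    · exact LemD1IndexedNonVacuityNonsplit.lemD1_1AsPrinted_of_character_of_rank_ne_two (Lf.single 1) lam hω₁ hcen hopen
        (by norm_num)
  have hN₀ : augmentation ω₀ S.scalar χ₁.1 = ⊥ := augmentation_eq_bot_of_character ω₀ S.scalar χ₁.1 1 hω₀ hcen1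
  have hN₁ : augmentation ω₁ S.scalar χ₁.1 = ⊥ := augmentation_eq_bot_of_character ω₁ S.scalar χ₁.1 lam hω₁ hcen
  have hiso10 : ¬ AreIsomorphicRep (Lf.quot 1) (Lf.quot 0) := fun h => hg₁ne (by
    have key := (areIsomorphicRep_quotRep_iff_of_character ω₁ ω₀ S.scalar_mem_center χ₁.1 χ₁.1 lam 1 hω₁ hω₀
      hN₁ hN₀).1 h
    rw [key, MonoidHom.one_apply])
  have hItem3 : LemD1_3AsPrintedI Lf := by
    intro _ i j
    fin_cases i <;> fin_cases j
    · exact iff_of_true (AreIsomorphicRep.refl _) ⟨rfl, LemD1.SameClass.refl _, rfl⟩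
    · exact iff_of_false hiso10 fun h => hflip h.2.1
    · exact iff_of_false (fun h => hiso10 h.symm) fun h => hflip h.2.1.symm
    · exact iff_of_true (AreIsomorphicRep.refl _) ⟨rfl, LemD1.SameClass.refl _, rfl⟩
  exact ⟨Lf, isField, hS, hgram, hItem1, hItem3, rfl, rfl, rfl, rfl, hflip, hiso10, fun h => hiso10 h.symm⟩

end Certificate

/-! ## §7 Closed form: the module topology of `ℚ₃(√3)` discharges the topological instance hypotheses of §6 -/

/-- **Closed form of the ramified certificate** (no instance hypotheses left): with `E = ℚ₃(√3)` carrying its module topology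
over `ℚ₃` (Mathlib `moduleTopology`), the collection of `exists_lemD1IndexedFamily_ramified_flip` exists; nothing in §6 is
vacuous. [cite: Liu2021, App. D Lemma D.1 (1) (l. 5229), (2) (l. 5231), (3) (l. 5233)] -/
theorem exists_lemD1IndexedFamily_ramified_flip_moduleTopology :
    letI : TopologicalSpace (QuadraticAlgebra ℚ_[3] 3 0) := moduleTopology ℚ_[3] (QuadraticAlgebra ℚ_[3] 3 0)
    haveI : IsModuleTopology ℚ_[3] (QuadraticAlgebra ℚ_[3] 3 0) := ⟨rfl⟩
    haveI : IsTopologicalRing (QuadraticAlgebra ℚ_[3] 3 0) :=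
      IsModuleTopology.isTopologicalRing ℚ_[3] (QuadraticAlgebra ℚ_[3] 3 0)
    ∃ Lf : LemD1IndexedFamily ℚ_[3] (QuadraticAlgebra ℚ_[3] 3 0) 3 (Fin 2),
      IsField (QuadraticAlgebra ℚ_[3] 3 0) ∧ Lf.Item1AsPrinted ∧ LemD1_3AsPrintedI Lf ∧
        Lf.mu 1 = Lf.mu 0 ∧ Lf.chi 1 = Lf.chi 0 ∧ Lf.eps 1 = LemD1.epsNeg (Lf.eps 0) ∧
        ¬ LemD1.SameClass (Lf.eps 0) (Lf.eps 1) ∧ ¬ AreIsomorphicRep (Lf.quot 1) (Lf.quot 0) := by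
  letI : TopologicalSpace (QuadraticAlgebra ℚ_[3] 3 0) := moduleTopology ℚ_[3] (QuadraticAlgebra ℚ_[3] 3 0)
  haveI : IsModuleTopology ℚ_[3] (QuadraticAlgebra ℚ_[3] 3 0) := ⟨rfl⟩
  haveI : IsTopologicalRing (QuadraticAlgebra ℚ_[3] 3 0) :=
    IsModuleTopology.isTopologicalRing ℚ_[3] (QuadraticAlgebra ℚ_[3] 3 0)
  obtain ⟨Lf, hF, -, -, h1, h3, hμ, hχ, -, hneg, hflip, hiso, -⟩ := exists_lemD1IndexedFamily_ramified_flip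
  exact ⟨Lf, hF, h1, h3, hμ, hχ, hneg, hflip, hiso⟩

end LemD1IndexedNonVacuityRamified

end Literature.NumberTheory.Automorphic.Liu2021

end
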